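import Literature.NumberTheory.Sieve.GreenTao2008SmoothMajorant
import Literature.NumberTheory.Sieve.SmoothMajorantMain
import Mathlib.Analysis.SpecialFunctions.Pow.Asymptotics
import Mathlib.Analysis.SpecialFunctions.Sqrt
import HarnessLib

/-!
# The smooth linear forms estimate (Conlon–Fox–Zhao Prop. 8.3): the discharge

Trunk T-SIEVE. D. Conlon, J. Fox, Y. Zhao, *The Green–Tao theorem: an exposition*
(arXiv:1403.2957 = EMS Surv. Math. Sci. 1 (2014)), §9 "Verifying the linear forms condition". This
file assembles `SmoothMajorantAssembly` (displays (28)–(29): expansion of `E_{x∈B} ∏_j Λ_{χ,R}(θ_j(x))²`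
and passage to the local densities) and `SmoothMajorantMain` ((30)–(38): Euler factors, the limit
`Q → ∞`, the pointwise main term, the full-space main integral) into

* `theorem smoothLinearFormsEstimate_holds : SmoothLinearFormsEstimate` — the named fact of
  `GreenTao2008SmoothMajorant` (CFZ Prop. 8.3 in the per-coefficient-bound form), **proved**; and
* `Literature.Parity.exists_prime_arithmetic_progression_of_relativeSzemeredi (hcfz : CFZ.RelativeSzemeredi)`:
  Green–Tao's Theorem 1.1 from the Conlon–Fox–Zhao relative Szemerédi theorem (CFZ Thm. 4.3) alone.

## Architecture (all proved)

1. `exists_norm_prod_eulerFactor_le`: the dominator `|∏_{p<Q} E_p(z(η))| ≤ (log R + C)^{3m} e^{2·4^m}`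
   ("Estimate (32)": `ζ(1 + 1/log R)^{O(1)}`), uniform in `Q, η, b, w` once `w ≥ 2C₀²`.
2. `Setup` bundles the standing hypotheses at fixed `N` (`R ≥ e`, `w ≥ 21m+2`, `w ≥ 2C₀²`, `|L| ≤ C₀`,
   rows nonzero and non-proportional). `Setup.trueSumC_eq_integral`: the tuple sum of (29) equals
   `∫_{ℝ^{2m}} Φ · Lim` **exactly** (`Φ(η) = ∏_v φ(η_v)`, `Lim` the limit of the partial Euler products,
   (33)–(35)), by the untruncated Fourier identity of `SmoothMajorantMain` and dominated convergence.
3. `Setup.norm_integral_limF_sub_main_le`: `‖∫ Φ Lim - (W/φ(W))^m ∫ Φ mainZ‖ ≤ E_tot (W/φ(W))^m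
   (2 log R)^{-m} M₂^{2m} + (B + (W/φ(W))^m (2 log R)^{-m}) tailBox(T)`: on the box `|η_v| ≤ T` the
   pointwise comparison (34)–(36) (`norm_limit_sub_main_le`), off the box crude bounds; here
   `E_tot = (1+α)(1+2β)(1+γ) - 1` (`alphaErr/betaErr/gammaErr/totErr`), `M₂ = ∫ |φ|(1+2π|·|)`.
4. `tailBox_le`: `tailBox(T) ≤ 2m T^{-A} M_A M₂^{2m-1}` (rapid decay of `φ`: "replace the domain of
   integration `I` by `ℝ` with a loss of `O_A(log^{-A} R)`").
5. `exists_expect_eq` + `Setup.abs_expect_div_sub_one_le`: with `integral_phiF_mainZ` ((37)–(38)) and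
   the box error of (29), `|E_B ∏Λ² / (c_χ W log R/φ(W))^m - 1| ≤ fixedErr(R, T, w)`.
6. Asymptotics (`tendsto_*`): with `T = log^{1/2} R`, `A = 8m + 2`, `G(N) = ⌊(log R)^{1/8}⌋` and any
   `w → ∞`, `w ≤ G`: `fixedErr → 0`, and the smallness side conditions hold eventually.

## References
* D. Conlon, J. Fox, Y. Zhao, EMS Surv. Math. Sci. 1 (2014), 249–282, Prop. 8.3 and §9. [cite: ConlonFoxZhao2014]
* B. Green, T. Tao, Ann. of Math. 171 (2010), App. D, Thm. D.3 (affine shifts). [cite: GreenTao2010]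
-/
noncomputable section

open Finset MeasureTheory Filter Topology
open scoped BigOperators Real

namespace Literature.NumberTheory.Sieve.CFZ

open GreenTao2008

variable {m : ℕ}

/-! ### The uniform bound `B(R)` on the partial Euler products -/

/-- `Re w_v(η) = 1/log R` for every slot. [cite: ConlonFoxZhao2014, Section 9] -/
theorem sumExp_zL_zR_re (R : ℝ) (η : Fin m ⊕ Fin m → ℝ) (v : Fin m ⊕ Fin m) :
    (sumExp (zL R η) (zR R η) v).re = 1 / Real.log R := by
  rw [show sumExp (zL R η) (zR R η) v = zOf R (η v) from sumExp_zOf R η v, zOf_re]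

/-- **The dominator** ("Estimate (32)": `∏_p E⁺_p ≤ ζ(1 + 1/log R)^{O(1)}` made explicit): for
`log R ≥ 1`, `W = ∏_{p≤w} p` with `w ≥ 2C₀²` and an integer system with `|L_{ij}| ≤ C₀`, nonzero and
pairwise non-proportional rows, every partial Euler product satisfies
`|∏_{p<Q} E_p(z(η))| ≤ (log R + C)^{3m} e^{2·4^m}`, uniformly in `Q`, `η`, the shifts `b` and `w`.
[cite: ConlonFoxZhao2014, Section 9, Error estimates, Estimate (32)] -/
theorem exists_norm_prod_eulerFactor_le : ∃ C : ℝ, 0 ≤ C ∧ ∀ (m n : ℕ) (R : ℝ), 1 ≤ Real.log R →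
    ∀ (w C₀ : ℕ), 2 * C₀ ^ 2 ≤ w → ∀ (L : Fin m → Fin (n + 1) → ℤ), (∀ i j, |L i j| ≤ C₀) →
    (∀ i, L i ≠ 0) →
    (∀ i i', i ≠ i' → ∀ c : ℚ, (fun j => (L i j : ℚ)) ≠ c • fun j => (L i' j : ℚ)) →
    ∀ (b : Fin m → ℤ) (Q : ℕ) (η : Fin m ⊕ Fin m → ℝ),
      ‖∏ p ∈ Q.primesBelow, eulerFactor p (primorial w) L b (zL R η) (zR R η)‖ ≤
        (Real.log R + C) ^ (3 * m) * Real.exp (2 * 4 ^ m) := by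
  obtain ⟨C, hC0, hC⟩ := prod_absLocalFactor_le
  refine ⟨C, hC0, fun m n R hR w C₀ hwC L hLC hL0 hLp b Q η => ?_⟩
  have hlogR : 0 < Real.log R := by linarith
  set s : ℝ := 1 / Real.log R with hs_def
  have hs0 : 0 < s := by positivity
  have hs1 : s ≤ 1 := by rw [hs_def, div_le_one hlogR]; exact hR
  set E : ℕ → ℝ := fun p => ∑ Y : Finset (Fin m ⊕ Fin m),
      localDensity₀ p (primorial w) L b (projPattern Y) * ∏ _v ∈ Y, (p : ℝ) ^ (-s) with hE_def
  have hre : ∀ v, (sumExp (zL R η) (zR R η) v).re = s := fun v => by rw [sumExp_zL_zR_re]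
  have hEp : ∀ p ∈ Q.primesBelow, ‖eulerFactor p (primorial w) L b (zL R η) (zR R η)‖ ≤ E p :=
    fun p hp => norm_eulerFactor_le_abs p (primorial w) (Nat.mem_primesBelow.1 hp).2.pos L b hre
  calc ‖∏ p ∈ Q.primesBelow, eulerFactor p (primorial w) L b (zL R η) (zR R η)‖
      ≤ ∏ p ∈ Q.primesBelow, ‖eulerFactor p (primorial w) L b (zL R η) (zR R η)‖ := norm_prod_le _ _
    _ ≤ ∏ p ∈ Q.primesBelow, E p := prod_le_prod (fun p _ => norm_nonneg _) hEp
    _ ≤ (1 / s + C) ^ (3 * m) * Real.exp (2 * 4 ^ m) := by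
        refine hC m Q E s hs0 hs1 (fun p hp => (norm_nonneg _).trans (hEp p hp)) (fun p hp => ?_)
        have hpp := (Nat.mem_primesBelow.1 hp).2
        haveI : Fact p.Prime := ⟨hpp⟩
        by_cases hpW : p ∣ primorial w
        · have h1 : E p = 1 := sum_localDensity_rpow_eq_one_of_dvd hpW L b s
          have h2 : 0 ≤ 3 * (m : ℝ) * (p : ℝ) ^ (-(1 + s)) + 4 ^ m / (p : ℝ) ^ 2 := by positivity
          linarith
        · have hpw : w < p := by rw [hpp.dvd_primorial_iff] at hpW; omega
          obtain ⟨hrow, hmin⟩ := nondegenerate_mod_of_bounds (p := p) (by omega) L hLC hL0 hLp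
          exact sum_localDensity_rpow_le hpW L b hrow hmin hs0.le
    _ = (Real.log R + C) ^ (3 * m) * Real.exp (2 * 4 ^ m) := by rw [hs_def, one_div_one_div]

/-! ### Standing hypotheses of the fixed-parameter analysis -/

/-- The standing hypotheses of §9 at fixed `N`: `R ≥ e` (so `log R ≥ 1`), `w ≥ 21m + 2` and
`w ≥ 2C₀²` ("`w` sufficiently large so that no two `ψ_i` are multiples of each other mod `p`" for
`p > w`, and the `O_m(p^{-2})` comparison of `E_p` with `E'_p`), and an integer system `L` with
`|L_{ij}| ≤ C₀`, nonzero rows, no two rows proportional. [cite: ConlonFoxZhao2014, Section 9] -/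
structure Setup (m n : ℕ) (R : ℝ) (w C₀ : ℕ) (L : Fin m → Fin (n + 1) → ℤ) : Prop where
  exp_le : Real.exp 1 ≤ R
  hw : 21 * m + 2 ≤ w
  hwC : 2 * C₀ ^ 2 ≤ w
  hLC : ∀ i j, |L i j| ≤ C₀
  hL0 : ∀ i, L i ≠ 0
  hLp : ∀ i i', i ≠ i' → ∀ c : ℚ, (fun j => (L i j : ℚ)) ≠ c • fun j => (L i' j : ℚ)

namespace Setup

variable {n : ℕ} {R : ℝ} {w C₀ : ℕ} {L : Fin m → Fin (n + 1) → ℤ}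

/-- `R > 1`. [cite: ConlonFoxZhao2014, Section 9] -/
theorem one_lt (S : Setup m n R w C₀ L) : 1 < R :=
  lt_of_lt_of_le (by have := Real.add_one_le_exp (1 : ℝ); linarith) S.exp_le

/-- `log R ≥ 1`. [cite: ConlonFoxZhao2014, Section 9] -/
theorem one_le_log (S : Setup m n R w C₀ L) : 1 ≤ Real.log R := by
  have h := Real.log_le_log (Real.exp_pos 1) S.exp_le
  rwa [Real.log_exp] at h

/-- `log R > 0`. [cite: ConlonFoxZhao2014, Section 9] -/
theorem log_pos (S : Setup m n R w C₀ L) : 0 < Real.log R := by linarith [S.one_le_log]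

/-- `w ≥ 1`. [cite: ConlonFoxZhao2014, Section 9] -/
theorem one_le_w (S : Setup m n R w C₀ L) : 1 ≤ w := by have := S.hw; omega

/-- `p ∣ W ↔ p ≤ w` for `W = ∏_{p ≤ w} p`. [cite: ConlonFoxZhao2014, Section 9] -/
theorem hW (_S : Setup m n R w C₀ L) : ∀ p : ℕ, p.Prime → (p ∣ primorial w ↔ p ≤ w) :=
  fun _ hp => hp.dvd_primorial_iff

end Setup

/-! ### The pointwise limit and the exact integral representation of the tuple sum -/

/-- **The pointwise limit** `Lim(η) = (∏_j ζ-ratio) / ∏_{p ≤ w} E'_p(z(η)) · ∏'_q (1 + δ'_q(η))` of the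
partial Euler products `∏_{p<Q} E_p(z(η))` ((33)–(35)). [cite: ConlonFoxZhao2014, Section 9, equations (33)–(35)] -/
def limF (R : ℝ) (W : ℕ) {n : ℕ} (L : Fin m → Fin (n + 1) → ℤ) (b : Fin m → ℤ) (w : ℕ)
    (η : Fin m ⊕ Fin m → ℝ) : ℂ :=
  zetaRatio R η / (∏ p ∈ (w + 1).primesBelow, eulerFactor' p (zL R η) (zR R η)) *
    ∏' q, (1 + deltaSeq R W L b w η q)

/-- **The tuple sum of (29)** (without the factor `(log R)^{2m}`), over `[1,R]^{[m] ⊔ [m]}`, as a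
complex number: `∑_{dd} E_{ℤ_D^t}[1_{dd ∣ θ}] ∏_v μ(dd_v) χ(log dd_v/log R)`.
[cite: ConlonFoxZhao2014, Section 9, equation (29)] -/
def trueSumC (χ : ℝ → ℝ) (R : ℝ) (W : ℕ) {t : ℕ} (L : Fin m → Fin t → ℤ) (b : Fin m → ℤ) : ℂ :=
  ∑ dd ∈ Fintype.piFinset (fun _ : Fin m ⊕ Fin m => Icc 1 ⌊R⌋₊),
    (tupleDensity W L b (fun j => dd (Sum.inl j)) (fun j => dd (Sum.inr j)) : ℂ) *
      ((∏ v, (ArithmeticFunction.moebius (dd v) : ℂ)) * ∏ v, ((χ (Real.log (dd v) / Real.log R) : ℝ) : ℂ))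

section LimitIdentification

variable {n : ℕ} {R : ℝ} {w C₀ : ℕ} {L : Fin m → Fin (n + 1) → ℤ}

/-- `∏_{p<Q} E_p(z(η)) → Lim(η)` under the standing hypotheses. [cite: ConlonFoxZhao2014, Section 9, equations (33)–(35)] -/
theorem Setup.tendsto_limF (S : Setup m n R w C₀ L) (b : Fin m → ℤ) (η : Fin m ⊕ Fin m → ℝ) :
    Tendsto (fun Q : ℕ => ∏ p ∈ Q.primesBelow, eulerFactor p (primorial w) L b (zL R η) (zR R η)) atTop
      (𝓝 (limF R (primorial w) L b w η)) :=
  tendsto_prod_eulerFactor R (primorial w) L b w η S.one_lt S.hW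
    (summable_norm_deltaSeq R (primorial w) L b w η S.one_lt S.hW S.hw S.hwC S.hLC S.hL0 S.hLp)

/-- `|Lim(η)| ≤ B` for any uniform bound `B` of the partial products. [cite: ConlonFoxZhao2014, Section 9] -/
theorem Setup.norm_limF_le (S : Setup m n R w C₀ L) (b : Fin m → ℤ) {B : ℝ}
    (hB : ∀ (Q : ℕ) (η : Fin m ⊕ Fin m → ℝ),
      ‖∏ p ∈ Q.primesBelow, eulerFactor p (primorial w) L b (zL R η) (zR R η)‖ ≤ B)
    (η : Fin m ⊕ Fin m → ℝ) : ‖limF R (primorial w) L b w η‖ ≤ B :=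
  le_of_tendsto (S.tendsto_limF b η).norm (Eventually.of_forall fun Q => hB Q η)

variable {χ : ℝ → ℝ} (hs : ContDiff ℝ (⊤ : ℕ∞) χ) (hsupp : ∀ x, 1 ≤ |x| → χ x = 0)

include hsupp in
/-- The summand of the tuple sum vanishes unless every entry is square-free, `≤ R`, and (hence) has all
prime factors `< Q` whenever `Q > ⌊R⌋`. [cite: ConlonFoxZhao2014, Section 9] -/
theorem tupleSummand_eq_zero (hR : 1 < R) (W : ℕ) {t : ℕ} (L' : Fin m → Fin t → ℤ) (b : Fin m → ℤ)
    {Q : ℕ} (hQ : ⌊R⌋₊ < Q) (dd : Fin m ⊕ Fin m → ℕ)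
    (hdd : ∃ v, dd v ∉ Icc 1 ⌊R⌋₊ ∩ squarefreeOf Q.primesBelow) :
    (tupleDensity W L' b (fun j => dd (Sum.inl j)) (fun j => dd (Sum.inr j)) : ℂ) *
      ((∏ v, (ArithmeticFunction.moebius (dd v) : ℂ)) * ∏ v, ((χ (Real.log (dd v) / Real.log R) : ℝ) : ℂ)) = 0 := by
  obtain ⟨v, hv⟩ := hdd
  have hP : ∀ p ∈ Q.primesBelow, p.Prime := fun p hp => (Nat.mem_primesBelow.1 hp).2
  by_cases hsq : Squarefree (dd v)
  · have hd1 : 1 ≤ dd v := Nat.pos_of_ne_zero hsq.ne_zero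
    by_cases hle : dd v ≤ ⌊R⌋₊
    · -- then `dd v` lies in the intersection: contradiction
      exfalso
      refine hv (mem_inter.2 ⟨mem_Icc.2 ⟨hd1, hle⟩, (mem_squarefreeOf hP).2 ⟨hsq, fun q hq => ?_⟩⟩)
      have hq := Nat.mem_primeFactors.1 hq
      exact Nat.mem_primesBelow.2 ⟨lt_of_le_of_lt ((Nat.le_of_dvd hd1 hq.2.1).trans hle) hQ, hq.1⟩
    · -- `dd v > R`: the cutoff vanishes
      have hgt : R < dd v := Nat.lt_of_floor_lt (not_le.1 hle)
      have hlogR : 0 < Real.log R := Real.log_pos hR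
      have hχ : χ (Real.log (dd v) / Real.log R) = 0 := by
        refine hsupp _ ?_
        rw [abs_of_nonneg (div_nonneg (Real.log_nonneg (by exact_mod_cast hd1)) hlogR.le), le_div_iff₀ hlogR,
          one_mul]
        exact Real.log_le_log (by linarith) hgt.le
      have h0 : ∏ v, ((χ (Real.log (dd v) / Real.log R) : ℝ) : ℂ) = 0 :=
        prod_eq_zero (mem_univ v) (by rw [hχ]; simp)
      rw [h0, mul_zero, mul_zero]
  · have h0 : ∏ v, (ArithmeticFunction.moebius (dd v) : ℂ) = 0 :=
      prod_eq_zero (mem_univ v) (by rw [ArithmeticFunction.moebius_eq_zero_of_not_squarefree hsq]; simp)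
    rw [h0, zero_mul, mul_zero]

include hs hsupp in
/-- **The tuple sum is the integral of `Φ · Lim` over `ℝ^{[m] ⊔ [m]}`, exactly**: for `Q > R` the tuple
sum equals `∫ Φ ∏_{p<Q} E_p` (`sum_coef_prod_chi_eq_integral`, re-indexed by
`sum_piFinset_eq_of_vanish`), a sequence constant in `Q` which converges to `∫ Φ · Lim` by dominated
convergence. [cite: ConlonFoxZhao2014, Section 9, equations (29), (32)–(35)] -/
theorem Setup.trueSumC_eq_integral (S : Setup m n R w C₀ L) (b : Fin m → ℤ) :
    trueSumC χ R (primorial w) L b =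
      ∫ η, (∏ v, phiF χ (η v)) * limF R (primorial w) L b w η ∂(fullMeasure m) := by
  obtain ⟨C, -, hB⟩ := exists_norm_prod_eulerFactor_le
  have hBound := hB m n R S.one_le_log w C₀ S.hwC L S.hLC S.hL0 S.hLp b
  have hconst : ∀ᶠ Q : ℕ in atTop,
      trueSumC χ R (primorial w) L b = ∫ η, (∏ v, phiF χ (η v)) *
        ∏ p ∈ Q.primesBelow, eulerFactor p (primorial w) L b (zL R η) (zR R η) ∂(fullMeasure m) := by
    filter_upwards [eventually_gt_atTop ⌊R⌋₊] with Q hQ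
    rw [← sum_coef_prod_chi_eq_integral hs hsupp S.one_lt (fun p hp => (Nat.mem_primesBelow.1 hp).2)]
    exact sum_piFinset_eq_of_vanish _ _ _ fun dd hdd => tupleSummand_eq_zero hsupp S.one_lt _ L b hQ dd hdd
  have hlim : ∀ η : Fin m ⊕ Fin m → ℝ, ∃ l : ℂ, Tendsto
      (fun Q : ℕ => ∏ p ∈ Q.primesBelow, eulerFactor p (primorial w) L b (zL R η) (zR R η)) atTop (𝓝 l) :=
    fun η => ⟨_, S.tendsto_limF b η⟩
  have h1 := tendsto_integral_prod_eulerFactor_full hs hsupp R (primorial w) L b hBound hlim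
  have h2 : Tendsto (fun Q : ℕ => ∫ η, (∏ v, phiF χ (η v)) *
      ∏ p ∈ Q.primesBelow, eulerFactor p (primorial w) L b (zL R η) (zR R η) ∂(fullMeasure m)) atTop
      (𝓝 (trueSumC χ R (primorial w) L b)) :=
    tendsto_const_nhds.congr' (hconst.mono fun Q hQ => hQ)
  rw [tendsto_nhds_unique h2 h1]
  refine integral_congr_ae (Eventually.of_forall fun η => ?_)
  show (∏ v, phiF χ (η v)) * (hlim η).choose = (∏ v, phiF χ (η v)) * limF R (primorial w) L b w η
  rw [tendsto_nhds_unique (hlim η).choose_spec (S.tendsto_limF b η)]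

end LimitIdentification

/-! ### Error parameters of the main-term analysis -/

/-- `δ = (1 + 2πT)/log R`, the size of `z(η)` on the box `|η_v| ≤ T`. [cite: ConlonFoxZhao2014, Section 9] -/
def deltaOf (R T : ℝ) : ℝ := (1 + 2 * Real.pi * T) / Real.log R

/-- `α = (1 + Kδ)^m - 1`: zeta ratios against `z z'/(z+z')` ((35)). [cite: ConlonFoxZhao2014, Section 9, equation (35)] -/
def alphaErr (K δ : ℝ) (m : ℕ) : ℝ := (1 + K * δ) ^ m - 1

/-- `β = (1 + U)^{π(w)} - 1`, `U = (1 + 144 δ log w)^m - 1`: the small primes ((36)).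
[cite: ConlonFoxZhao2014, Section 9, equation (36)] -/
def betaErr (δ : ℝ) (m w : ℕ) : ℝ :=
  (1 + ((1 + 144 * δ * Real.log w) ^ m - 1)) ^ #((w + 1).primesBelow) - 1

/-- `γ = e^{deltaConst(m)/w} - 1`: the correction product `∏_{p>w} (1 + O(p^{-2}))` ((34)).
[cite: ConlonFoxZhao2014, Section 9, equation (34)] -/
def gammaErr (m w : ℕ) : ℝ := Real.exp (deltaConst m / w) - 1

/-- The total relative error `(1+α)(1+2β)(1+γ) - 1` of the main term on the box.
[cite: ConlonFoxZhao2014, Section 9, equations (34)–(36)] -/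
def totErr (K δ : ℝ) (m w : ℕ) : ℝ :=
  (1 + alphaErr K δ m) * (1 + 2 * betaErr δ m w) * (1 + gammaErr m w) - 1

/-- `(W/φ(W))^m`, written `((φ(W)/W)^m)⁻¹`, `W = ∏_{p ≤ w} p`. [cite: ConlonFoxZhao2014, Section 9, equation (37)] -/
def cW (w m : ℕ) : ℝ := ((((Nat.totient (primorial w)) : ℝ) / primorial w) ^ m)⁻¹

/-- `δ ≥ 0` for `T ≥ 0`, `log R > 0`. [cite: ConlonFoxZhao2014, Section 9] -/
theorem deltaOf_nonneg {R T : ℝ} (hT : 0 ≤ T) (hR : 0 < Real.log R) : 0 ≤ deltaOf R T := by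
  unfold deltaOf; positivity

/-- `α ≥ 0`. [cite: ConlonFoxZhao2014, Section 9] -/
theorem alphaErr_nonneg {K δ : ℝ} (hK : 0 ≤ K) (hδ : 0 ≤ δ) (m : ℕ) : 0 ≤ alphaErr K δ m := by
  unfold alphaErr
  have : 1 ≤ (1 + K * δ) ^ m := one_le_pow₀ (by nlinarith)
  linarith

/-- `β ≥ 0`. [cite: ConlonFoxZhao2014, Section 9] -/
theorem betaErr_nonneg {δ : ℝ} (hδ : 0 ≤ δ) (m w : ℕ) : 0 ≤ betaErr δ m w := by
  unfold betaErr
  have hlog : 0 ≤ Real.log w := Real.log_natCast_nonneg w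
  have h1 : 1 ≤ (1 + 144 * δ * Real.log w) ^ m := one_le_pow₀ (by nlinarith)
  have h2 : 1 ≤ (1 + ((1 + 144 * δ * Real.log w) ^ m - 1)) ^ #((w + 1).primesBelow) := one_le_pow₀ (by linarith)
  linarith

/-- `γ ≥ 0`. [cite: ConlonFoxZhao2014, Section 9] -/
theorem gammaErr_nonneg (m w : ℕ) : 0 ≤ gammaErr m w := by
  unfold gammaErr
  have : 1 ≤ Real.exp (deltaConst m / w) := Real.one_le_exp (div_nonneg (deltaConst_nonneg m) (Nat.cast_nonneg _))
  linarith

/-- The total error is `≥ 0`. [cite: ConlonFoxZhao2014, Section 9] -/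
theorem totErr_nonneg {K δ : ℝ} (hK : 0 ≤ K) (hδ : 0 ≤ δ) (m w : ℕ) : 0 ≤ totErr K δ m w := by
  unfold totErr
  have ha := alphaErr_nonneg hK hδ m
  have hb := betaErr_nonneg hδ m w
  have hc := gammaErr_nonneg m w
  nlinarith [mul_nonneg ha hb, mul_nonneg (mul_nonneg ha hb) hc, mul_nonneg ha hc, mul_nonneg hb hc]

/-- `(W/φ(W))^m ≥ 1`. [cite: ConlonFoxZhao2014, Section 9] -/
theorem one_le_cW (w m : ℕ) : 1 ≤ cW w m := by
  unfold cW
  have hW : (0 : ℝ) < primorial w := by exact_mod_cast primorial_pos w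
  have hφ0 : (0 : ℝ) < Nat.totient (primorial w) := by exact_mod_cast Nat.totient_pos.2 (primorial_pos w)
  have hφ1 : (Nat.totient (primorial w) : ℝ) / primorial w ≤ 1 := by
    rw [div_le_one hW]; exact_mod_cast Nat.totient_le _
  have hq0 : 0 < (Nat.totient (primorial w) : ℝ) / primorial w := by positivity
  exact one_le_inv_iff₀.2 ⟨pow_pos hq0 m, pow_le_one₀ hq0.le hφ1⟩

/-- `(W/φ(W))^m > 0`. [cite: ConlonFoxZhao2014, Section 9] -/
theorem cW_pos (w m : ℕ) : 0 < cW w m := lt_of_lt_of_le one_pos (one_le_cW w m)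

/-! ### The box `|η_v| ≤ T`, the product weight, and the tail integral -/

/-- The box `{η : |η_v| ≤ T ∀ v}` (`I^{2m}` with `I = [-T, T]`). [cite: ConlonFoxZhao2014, Section 9] -/
def box (m : ℕ) (T : ℝ) : Set (Fin m ⊕ Fin m → ℝ) := {η | ∀ v, |η v| ≤ T}

/-- The box is closed. [folklore] -/
theorem isClosed_box (m : ℕ) (T : ℝ) : IsClosed (box m T) := by
  have h : box m T = ⋂ v, (fun η : Fin m ⊕ Fin m → ℝ => |η v|) ⁻¹' Set.Iic T := by
    ext η; simp [box]
  rw [h]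
  exact isClosed_iInter fun v => isClosed_Iic.preimage (continuous_abs.comp (continuous_apply v))

/-- The box is measurable. [folklore] -/
theorem measurableSet_box (m : ℕ) (T : ℝ) : MeasurableSet (box m T) := (isClosed_box m T).measurableSet

/-- The product weight `G(η) = ∏_v g(η_v)`, `g = |φ|(1 + 2π|·|)`. [cite: ConlonFoxZhao2014, Section 9] -/
def prodWeight (χ : ℝ → ℝ) (η : Fin m ⊕ Fin m → ℝ) : ℝ := ∏ v, phiWeight χ (η v)

/-- `G ≥ 0`. [cite: ConlonFoxZhao2014, Section 9] -/
theorem prodWeight_nonneg (χ : ℝ → ℝ) (η : Fin m ⊕ Fin m → ℝ) : 0 ≤ prodWeight χ η :=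
  prod_nonneg fun v _ => by unfold phiWeight; positivity

/-- `‖Φ(η)‖ ≤ G(η)` (`1 ≤ 1 + 2π|x|`). [cite: ConlonFoxZhao2014, Section 9] -/
theorem norm_prod_phiF_le_prodWeight (χ : ℝ → ℝ) (η : Fin m ⊕ Fin m → ℝ) :
    ‖∏ v, phiF χ (η v)‖ ≤ prodWeight χ η := by
  rw [norm_prod]
  unfold prodWeight phiWeight
  refine prod_le_prod (fun v _ => norm_nonneg _) fun v _ => ?_
  have h1 : (1 : ℝ) ≤ 1 + 2 * Real.pi * |η v| := by nlinarith [Real.pi_pos, abs_nonneg (η v)]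
  calc ‖phiF χ (η v)‖ = ‖phiF χ (η v)‖ * 1 := (mul_one _).symm
    _ ≤ ‖phiF χ (η v)‖ * (1 + 2 * Real.pi * |η v|) := mul_le_mul_of_nonneg_left h1 (norm_nonneg _)

/-- `‖Φ(η)‖ · ‖mainZ(η)‖ ≤ (2 log R)^{-m} G(η)`. [cite: ConlonFoxZhao2014, Section 9] -/
theorem norm_prod_phiF_mul_norm_mainZ_le (χ : ℝ → ℝ) {R : ℝ} (hR : 1 < R) (η : Fin m ⊕ Fin m → ℝ) :
    ‖∏ v, phiF χ (η v)‖ * ‖mainZ R η‖ ≤ ((2 * Real.log R) ^ m)⁻¹ * prodWeight χ η := by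
  calc ‖∏ v, phiF χ (η v)‖ * ‖mainZ R η‖
      ≤ ‖∏ v, phiF χ (η v)‖ * (((2 * Real.log R) ^ m)⁻¹ * ∏ v, (1 + 2 * Real.pi * |η v|)) :=
        mul_le_mul_of_nonneg_left (norm_mainZ_le hR η) (norm_nonneg _)
    _ = ((2 * Real.log R) ^ m)⁻¹ * ((∏ v, ‖phiF χ (η v)‖) * ∏ v, (1 + 2 * Real.pi * |η v|)) := by
        rw [norm_prod]; ring
    _ = ((2 * Real.log R) ^ m)⁻¹ * prodWeight χ η := by rw [← prod_mul_distrib]; rfl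

/-- `mainZ` is continuous (`R > 1`). [cite: ConlonFoxZhao2014, Section 9] -/
theorem continuous_mainZ {R : ℝ} (hR : 1 < R) : Continuous (mainZ (m := m) R) := by
  unfold mainZ zL zR
  refine continuous_finsetProd _ fun j _ => ?_
  have hz := continuous_zOf R
  have h1 : Continuous fun η : Fin m ⊕ Fin m → ℝ => η (Sum.inl j) := continuous_apply _
  have h2 : Continuous fun η : Fin m ⊕ Fin m → ℝ => η (Sum.inr j) := continuous_apply _
  exact ((hz.comp h1).mul (hz.comp h2)).div ((hz.comp h1).add (hz.comp h2)) fun η => (zOf_ne_zero hR _ _).2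

section Weight

variable {χ : ℝ → ℝ} (hs : ContDiff ℝ (⊤ : ℕ∞) χ) (hsupp : ∀ x, 1 ≤ |x| → χ x = 0)
include hs hsupp

/-- `G` is integrable on `ℝ^{[m] ⊔ [m]}`. [cite: ConlonFoxZhao2014, Section 9] -/
theorem integrable_prodWeight : Integrable (prodWeight (m := m) χ) (fullMeasure m) := by
  unfold fullMeasure
  exact Integrable.fintype_prod (f := fun _ x => phiWeight χ x) fun _ => integrable_phiWeight hs hsupp

end Weight

/-- `∫ G = (∫ g)^{2m}`. [cite: ConlonFoxZhao2014, Section 9] -/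
theorem integral_prodWeight (χ : ℝ → ℝ) :
    ∫ η, prodWeight χ η ∂(fullMeasure m) = (∫ x, phiWeight χ x) ^ (2 * m) := by
  unfold fullMeasure prodWeight
  rw [integral_fintype_prod_eq_prod (f := fun _ x => phiWeight χ x), prod_const, card_univ, Fintype.card_sum,
    Fintype.card_fin, two_mul]

/-- **The tail integral** `∫_{ℝ^{2m} ∖ I^{2m}} G` of the product weight off the box.
[cite: ConlonFoxZhao2014, Section 9] -/
def tailBox (χ : ℝ → ℝ) (m : ℕ) (T : ℝ) : ℝ := ∫ η, (box m T)ᶜ.indicator (prodWeight χ) η ∂(fullMeasure m)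

/-- `tailBox ≥ 0`. [cite: ConlonFoxZhao2014, Section 9] -/
theorem tailBox_nonneg (χ : ℝ → ℝ) (m : ℕ) (T : ℝ) : 0 ≤ tailBox χ m T :=
  integral_nonneg fun _ => Set.indicator_nonneg (fun _ _ => prodWeight_nonneg χ _) _

/-! ### The main estimate at fixed parameters -/

section MainEstimate

variable {n : ℕ} {R : ℝ} {w C₀ : ℕ} {L : Fin m → Fin (n + 1) → ℤ}
variable {χ : ℝ → ℝ} (hs : ContDiff ℝ (⊤ : ℕ∞) χ) (hsupp : ∀ x, 1 ≤ |x| → χ x = 0)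

/-- `‖∏'(1 + δ') - 1‖ ≤ γ`. [cite: ConlonFoxZhao2014, Section 9, equation (34)] -/
theorem Setup.norm_tprod_deltaSeq_sub_one_le (S : Setup m n R w C₀ L) (b : Fin m → ℤ) (η : Fin m ⊕ Fin m → ℝ) :
    ‖∏' q, (1 + deltaSeq R (primorial w) L b w η q) - 1‖ ≤ gammaErr m w := by
  have hsmall : ∀ q, q ≤ w → deltaSeq R (primorial w) L b w η q = 0 := by
    intro q hq
    unfold deltaSeq
    rw [if_neg]
    rintro ⟨-, h⟩
    omega
  have hdecay : ∀ q, w < q → ‖deltaSeq R (primorial w) L b w η q‖ ≤ deltaConst m / (q : ℝ) ^ 2 :=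
    fun q _ => norm_deltaSeq_le R (primorial w) L b w η S.one_lt S.hW S.hw S.hwC S.hLC S.hL0 S.hLp q
  exact (norm_tprod_sub_one_le_of_sq_decay _ (deltaConst_nonneg m) S.one_le_w hsmall hdecay).2.2

include hs hsupp in
/-- **The main estimate at fixed parameters** ((33)–(37) with explicit errors): with
`Φ(η) = ∏_v φ(η_v)`, `c = (W/φ(W))^m`, `κ = (2 log R)^{-m}`, `M₂ = ∫ g`,
`‖∫ Φ·Lim - c ∫ Φ·mainZ‖ ≤ E_tot · c κ M₂^{2m} + (B + c κ) · tailBox(T)`: on the box the pointwise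
comparison `norm_limit_sub_main_le`, off the box the crude bounds `|Lim| ≤ B`, `|mainZ| ≤ κ ∏(1+2π|η_v|)`.
[cite: ConlonFoxZhao2014, Section 9, equations (33)–(37)] -/
theorem Setup.norm_integral_limF_sub_main_le (S : Setup m n R w C₀ L) (b : Fin m → ℤ) {T δ₀ K : ℝ}
    (hT : 0 ≤ T) (hK : 0 ≤ K)
    (hζ : ∀ z z' : ℂ, z ≠ 0 → z' ≠ 0 → z + z' ≠ 0 → ∀ δ : ℝ, δ ≤ δ₀ → ‖z‖ ≤ δ → ‖z'‖ ≤ δ →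
      ‖riemannZeta (1 + z + z') / (riemannZeta (1 + z) * riemannZeta (1 + z')) - z * z' / (z + z')‖ ≤
        K * δ * ‖z * z' / (z + z')‖)
    (hδ₀ : deltaOf R T ≤ δ₀) (hδw : 2 * deltaOf R T * Real.log w ≤ 1 / 8)
    (hβ : betaErr (deltaOf R T) m w ≤ 1 / 2) {B : ℝ}
    (hB : ∀ (Q : ℕ) (η : Fin m ⊕ Fin m → ℝ),
      ‖∏ p ∈ Q.primesBelow, eulerFactor p (primorial w) L b (zL R η) (zR R η)‖ ≤ B) :
    ‖(∫ η, (∏ v, phiF χ (η v)) * limF R (primorial w) L b w η ∂(fullMeasure m)) -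
        (cW w m : ℂ) * ∫ η, (∏ v, phiF χ (η v)) * mainZ R η ∂(fullMeasure m)‖ ≤
      totErr K (deltaOf R T) m w * cW w m * ((2 * Real.log R) ^ m)⁻¹ * (∫ x, phiWeight χ x) ^ (2 * m) +
        (B + cW w m * ((2 * Real.log R) ^ m)⁻¹) * tailBox χ m T := by
  have hR := S.one_lt
  have hlogR := S.log_pos
  set Φ : (Fin m ⊕ Fin m → ℝ) → ℂ := fun η => ∏ v, phiF χ (η v) with hΦ_def
  set Lim : (Fin m ⊕ Fin m → ℝ) → ℂ := limF R (primorial w) L b w with hLim_def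
  set c : ℝ := cW w m with hc_def
  set κ : ℝ := ((2 * Real.log R) ^ m)⁻¹ with hκ_def
  set E : ℝ := totErr K (deltaOf R T) m w with hEtot_def
  have hc0 : 0 ≤ c := (cW_pos w m).le
  have hκ0 : 0 ≤ κ := by positivity
  have hB0 : 0 ≤ B := (norm_nonneg _).trans (hB 0 0)
  have hE0 : 0 ≤ E := totErr_nonneg hK (deltaOf_nonneg hT hlogR) m w
  -- integrability
  have hφi := phiF_integrable hs hsupp
  have hφc : Continuous (phiF χ) := by rw [← phiS_coe hs hsupp]; exact (phiS hs hsupp).continuous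
  have hΦc : Continuous Φ := continuous_finsetProd _ fun v _ => hφc.comp (continuous_apply v)
  have hΦi : Integrable Φ (fullMeasure m) := by
    unfold fullMeasure; exact Integrable.fintype_prod (f := fun _ x => phiF χ x) fun _ => hφi
  have hGi : Integrable (prodWeight χ) (fullMeasure m) := integrable_prodWeight hs hsupp
  have hLim_meas : AEStronglyMeasurable (fun η => Φ η * Lim η) (fullMeasure m) := by
    refine aestronglyMeasurable_of_tendsto_ae (atTop : Filter ℕ)
      (f := fun Q η => Φ η * ∏ p ∈ Q.primesBelow, eulerFactor p (primorial w) L b (zL R η) (zR R η))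
      (fun Q => ?_) (Eventually.of_forall fun η => tendsto_const_nhds.mul (S.tendsto_limF b η))
    refine (hΦc.mul ?_).aestronglyMeasurable
    exact continuous_finsetProd _ fun p hp =>
      continuous_eulerFactor_zOf R p (primorial w) (Nat.mem_primesBelow.1 hp).2.pos L b
  have hLim_int : Integrable (fun η => Φ η * Lim η) (fullMeasure m) := by
    refine (hΦi.norm.mul_const B).mono' hLim_meas (Eventually.of_forall fun η => ?_)
    rw [norm_mul]
    exact mul_le_mul_of_nonneg_left (S.norm_limF_le b hB η) (norm_nonneg _)
  have hmain_int : Integrable (fun η => Φ η * mainZ R η) (fullMeasure m) := by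
    refine (hGi.const_mul κ).mono' (hΦc.mul (continuous_mainZ hR)).aestronglyMeasurable
      (Eventually.of_forall fun η => ?_)
    rw [norm_mul]
    exact norm_prod_phiF_mul_norm_mainZ_le χ hR η
  -- combine the two integrals into one
  have hsub : (∫ η, Φ η * Lim η ∂(fullMeasure m)) - (c : ℂ) * ∫ η, Φ η * mainZ R η ∂(fullMeasure m) =
      ∫ η, (Φ η * Lim η - (c : ℂ) * (Φ η * mainZ R η)) ∂(fullMeasure m) := by
    rw [← integral_const_mul, ← integral_sub hLim_int (hmain_int.const_mul _)]
  rw [hsub]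
  -- the pointwise bound
  have hpt : ∀ η, ‖Φ η * Lim η - (c : ℂ) * (Φ η * mainZ R η)‖ ≤
      E * c * κ * prodWeight χ η + (B + c * κ) * (box m T)ᶜ.indicator (prodWeight χ) η := by
    intro η
    have hfac : Φ η * Lim η - (c : ℂ) * (Φ η * mainZ R η) = Φ η * (Lim η - mainZ R η * (c : ℂ)) := by ring
    rw [hfac, norm_mul]
    have hG0 : 0 ≤ prodWeight χ η := prodWeight_nonneg χ η
    have h1 : ‖Φ η‖ ≤ prodWeight χ η := norm_prod_phiF_le_prodWeight χ η
    have h2 : ‖Φ η‖ * ‖mainZ R η‖ ≤ κ * prodWeight χ η := norm_prod_phiF_mul_norm_mainZ_le χ hR η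
    by_cases hη : η ∈ box m T
    · -- on the box: the pointwise main-term comparison
      have hηT : ∀ v, |η v| ≤ T := hη
      have hpw : ‖Lim η - mainZ R η * (c : ℂ)‖ ≤ E * (‖mainZ R η‖ * c) :=
        norm_limit_sub_main_le hζ hR hT hδ₀ hδw hβ η hηT _ (S.norm_tprod_deltaSeq_sub_one_le b η)
      rw [Set.indicator_of_notMem (by rw [Set.mem_compl_iff, not_not]; exact hη), mul_zero, add_zero]
      calc ‖Φ η‖ * ‖Lim η - mainZ R η * (c : ℂ)‖ ≤ ‖Φ η‖ * (E * (‖mainZ R η‖ * c)) :=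
            mul_le_mul_of_nonneg_left hpw (norm_nonneg _)
        _ = E * c * (‖Φ η‖ * ‖mainZ R η‖) := by ring
        _ ≤ E * c * (κ * prodWeight χ η) := mul_le_mul_of_nonneg_left h2 (mul_nonneg hE0 hc0)
        _ = E * c * κ * prodWeight χ η := by ring
    · -- off the box: crude bounds
      rw [Set.indicator_of_mem (Set.mem_compl hη)]
      have h3 : ‖Lim η - mainZ R η * (c : ℂ)‖ ≤ B + ‖mainZ R η‖ * c := by
        refine (norm_sub_le _ _).trans (add_le_add (S.norm_limF_le b hB η) ?_)
        rw [norm_mul, Complex.norm_real, Real.norm_eq_abs, abs_of_nonneg hc0]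
      calc ‖Φ η‖ * ‖Lim η - mainZ R η * (c : ℂ)‖ ≤ ‖Φ η‖ * (B + ‖mainZ R η‖ * c) :=
            mul_le_mul_of_nonneg_left h3 (norm_nonneg _)
        _ = B * ‖Φ η‖ + c * (‖Φ η‖ * ‖mainZ R η‖) := by ring
        _ ≤ B * prodWeight χ η + c * (κ * prodWeight χ η) := by gcongr
        _ = (B + c * κ) * prodWeight χ η := by ring
        _ ≤ E * c * κ * prodWeight χ η + (B + c * κ) * prodWeight χ η :=
            le_add_of_nonneg_left (by positivity)
  -- integrate the bound
  have hbound_int : Integrable (fun η => E * c * κ * prodWeight χ η +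
      (B + c * κ) * (box m T)ᶜ.indicator (prodWeight χ) η) (fullMeasure m) :=
    (hGi.const_mul _).add ((hGi.indicator (measurableSet_box m T).compl).const_mul _)
  calc ‖∫ η, (Φ η * Lim η - (c : ℂ) * (Φ η * mainZ R η)) ∂(fullMeasure m)‖
      ≤ ∫ η, (E * c * κ * prodWeight χ η + (B + c * κ) * (box m T)ᶜ.indicator (prodWeight χ) η)
          ∂(fullMeasure m) := norm_integral_le_of_norm_le hbound_int (Eventually.of_forall hpt)
    _ = E * c * κ * (∫ η, prodWeight χ η ∂(fullMeasure m)) + (B + c * κ) * tailBox χ m T := by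
        rw [integral_add (hGi.const_mul _) ((hGi.indicator (measurableSet_box m T).compl).const_mul _),
          integral_const_mul, integral_const_mul]
        rfl
    _ = E * c * κ * (∫ x, phiWeight χ x) ^ (2 * m) + (B + c * κ) * tailBox χ m T := by
        rw [integral_prodWeight χ]

end MainEstimate

/-! ### The tail off the box: `tailBox(T) ≤ 2m · T^{-A} M_A · M₂^{2m-1}` -/

section Tail

variable {χ : ℝ → ℝ}

/-- `g ≥ 0`. [cite: ConlonFoxZhao2014, Section 9] -/
theorem phiWeight_nonneg (χ : ℝ → ℝ) (x : ℝ) : 0 ≤ phiWeight χ x := by unfold phiWeight; positivity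

/-- The one-dimensional tail `∫_{|x| > T} g`. [cite: ConlonFoxZhao2014, Section 9] -/
def tail₁ (χ : ℝ → ℝ) (T : ℝ) : ℝ := ∫ x, {x : ℝ | T < |x|}.indicator (phiWeight χ) x

/-- The moment `M_A = ∫ g(x) (1 + |x|)^A dx` (finite by the rapid decay of `φ`). [cite: ConlonFoxZhao2014, Section 9] -/
def weightMoment (χ : ℝ → ℝ) (A : ℕ) : ℝ := ∫ x, phiWeight χ x * (1 + |x|) ^ A

/-- `{x : T < |x|}` is measurable. [folklore] -/
theorem measurableSet_tailSet (T : ℝ) : MeasurableSet {x : ℝ | T < |x|} :=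
  (isOpen_lt continuous_const continuous_abs).measurableSet

/-- `tail₁ ≥ 0`. [cite: ConlonFoxZhao2014, Section 9] -/
theorem tail₁_nonneg (χ : ℝ → ℝ) (T : ℝ) : 0 ≤ tail₁ χ T :=
  integral_nonneg fun _ => Set.indicator_nonneg (fun _ _ => phiWeight_nonneg χ _) _

/-- `M_A ≥ 0`. [cite: ConlonFoxZhao2014, Section 9] -/
theorem weightMoment_nonneg (χ : ℝ → ℝ) (A : ℕ) : 0 ≤ weightMoment χ A :=
  integral_nonneg fun x => mul_nonneg (phiWeight_nonneg χ x) (by positivity)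

/-- Pointwise: the indicator of the complement of the box is at most the sum over the slots `v` of
the indicators of `T < |η_v|` (times `G`). [folklore] -/
theorem indicator_compl_box_le (χ : ℝ → ℝ) (T : ℝ) (η : Fin m ⊕ Fin m → ℝ) :
    (box m T)ᶜ.indicator (prodWeight χ) η ≤
      ∑ v, {x : ℝ | T < |x|}.indicator (fun _ => prodWeight χ η) (η v) := by
  have h0 : ∀ v, 0 ≤ {x : ℝ | T < |x|}.indicator (fun _ => prodWeight χ η) (η v) :=
    fun v => Set.indicator_nonneg (fun _ _ => prodWeight_nonneg χ η) _
  by_cases hη : η ∈ box m T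
  · rw [Set.indicator_of_notMem (by rw [Set.mem_compl_iff, not_not]; exact hη)]
    exact sum_nonneg fun v _ => h0 v
  · rw [Set.indicator_of_mem (Set.mem_compl hη)]
    obtain ⟨v, hv⟩ : ∃ v, T < |η v| := by
      by_contra h
      push Not at h
      exact hη h
    calc prodWeight χ η = {x : ℝ | T < |x|}.indicator (fun _ => prodWeight χ η) (η v) := by
          rw [Set.indicator_of_mem (by exact hv)]
      _ ≤ ∑ v, {x : ℝ | T < |x|}.indicator (fun _ => prodWeight χ η) (η v) :=
          single_le_sum (fun u _ => h0 u) (mem_univ v)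

/-- The slot-`v` factors: `g` truncated to `|x| > T` in slot `v`, `g` elsewhere. [folklore] -/
def slotF (χ : ℝ → ℝ) (T : ℝ) (v u : Fin m ⊕ Fin m) : ℝ → ℝ :=
  if u = v then {x : ℝ | T < |x|}.indicator (phiWeight χ) else phiWeight χ

/-- `∏_u slotF_u(η_u) = 1[T < |η_v|] G(η)`. [folklore] -/
theorem prod_slotF_eq (χ : ℝ → ℝ) (T : ℝ) (v : Fin m ⊕ Fin m) (η : Fin m ⊕ Fin m → ℝ) :
    ∏ u, slotF χ T v u (η u) = {x : ℝ | T < |x|}.indicator (fun _ => prodWeight χ η) (η v) := by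
  by_cases hv : T < |η v|
  · rw [Set.indicator_of_mem (by exact hv)]
    unfold prodWeight
    refine prod_congr rfl fun u _ => ?_
    unfold slotF
    split_ifs with h
    · subst h; rw [Set.indicator_of_mem (by exact hv)]
    · rfl
  · rw [Set.indicator_of_notMem (by exact hv)]
    refine prod_eq_zero (mem_univ v) ?_
    simp only [slotF, if_true]
    rw [Set.indicator_of_notMem (by exact hv)]

/-- `∫ 1[T < |η_v|] G(η) dη = tail₁(T) · M₂^{2m-1}`. [folklore] -/
theorem integral_slot_tail (χ : ℝ → ℝ) (T : ℝ) (v : Fin m ⊕ Fin m) :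
    ∫ η, {x : ℝ | T < |x|}.indicator (fun _ => prodWeight χ η) (η v) ∂(fullMeasure m) =
      tail₁ χ T * (∫ x, phiWeight χ x) ^ (2 * m - 1) := by
  classical
  simp_rw [← prod_slotF_eq]
  unfold fullMeasure
  rw [integral_fintype_prod_eq_prod (f := fun u x => slotF χ T v u x),
    ← mul_prod_erase univ (fun u => ∫ x, slotF χ T v u x) (mem_univ v)]
  congr 1
  · simp [slotF, tail₁]
  · rw [prod_congr rfl fun u hu => show (∫ x, slotF χ T v u x) = ∫ x, phiWeight χ x by
        rw [show slotF χ T v u = phiWeight χ from if_neg (ne_of_mem_erase hu)],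
      prod_const, card_erase_of_mem (mem_univ v), card_univ, Fintype.card_sum, Fintype.card_fin, two_mul]

variable (hs : ContDiff ℝ (⊤ : ℕ∞) χ) (hsupp : ∀ x, 1 ≤ |x| → χ x = 0)
include hs hsupp

/-- `g(x)(1 + |x|)^A` is integrable (rapid decay of `φ` with exponent `A + 3`). [cite: ConlonFoxZhao2014, Section 9] -/
theorem integrable_weightMoment (A : ℕ) : Integrable (fun x => phiWeight χ x * (1 + |x|) ^ A) := by
  obtain ⟨C, hC0, hφ⟩ := norm_phiF_le hs hsupp (A + 3)
  have hint : Integrable fun x : ℝ => (2 * Real.pi * C) * (1 + ‖x‖) ^ (-(2 : ℝ)) :=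
    (integrable_one_add_norm (by simp)).const_mul _
  have hφc : Continuous (phiF χ) := by rw [← phiS_coe hs hsupp]; exact (phiS hs hsupp).continuous
  have hcont : Continuous (fun x => phiWeight χ x * (1 + |x|) ^ A) := by unfold phiWeight; fun_prop
  refine hint.mono' hcont.aestronglyMeasurable (Eventually.of_forall fun x => ?_)
  rw [Real.norm_eq_abs, abs_of_nonneg (mul_nonneg (phiWeight_nonneg χ x) (by positivity))]
  unfold phiWeight
  have hx : 0 < 1 + |x| := by positivity
  have h1 : 1 + 2 * Real.pi * |x| ≤ 2 * Real.pi * (1 + |x|) := by nlinarith [Real.pi_gt_three, abs_nonneg x]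
  calc ‖phiF χ x‖ * (1 + 2 * Real.pi * |x|) * (1 + |x|) ^ A
      ≤ (C * ((1 + |x|) ^ (A + 3))⁻¹) * (2 * Real.pi * (1 + |x|)) * (1 + |x|) ^ A := by
        gcongr
        exact hφ x
    _ = (2 * Real.pi * C) * (1 + ‖x‖) ^ (-(2 : ℝ)) := by
        rw [Real.norm_eq_abs, Real.rpow_neg hx.le, show ((1 + |x|) ^ (2 : ℝ)) = (1 + |x|) ^ (2 : ℕ) by norm_cast]
        field_simp
        ring

/-- **The one-dimensional tail**: `tail₁(T) ≤ T^{-A} M_A` for `T ≥ 1` (`1[|x|>T] ≤ (1+|x|)^A/T^A`).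
[cite: ConlonFoxZhao2014, Section 9] -/
theorem tail₁_le (A : ℕ) {T : ℝ} (hT : 1 ≤ T) : tail₁ χ T ≤ (T ^ A)⁻¹ * weightMoment χ A := by
  unfold tail₁ weightMoment
  rw [← integral_const_mul]
  refine integral_mono_of_nonneg (ae_of_all _ fun x => Set.indicator_nonneg (fun _ _ => phiWeight_nonneg χ _) _)
    ((integrable_weightMoment hs hsupp A).const_mul _) (ae_of_all _ fun x => ?_)
  have hTA : 0 < T ^ A := by positivity
  by_cases hx : T < |x|
  · rw [Set.indicator_of_mem (by exact hx)]
    have hg := phiWeight_nonneg χ x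
    have h1 : 1 ≤ (T ^ A)⁻¹ * (1 + |x|) ^ A := by
      rw [inv_mul_eq_div, le_div_iff₀ hTA, one_mul]
      exact pow_le_pow_left₀ (by linarith) (by linarith [hx.le]) A
    calc phiWeight χ x = 1 * phiWeight χ x := (one_mul _).symm
      _ ≤ ((T ^ A)⁻¹ * (1 + |x|) ^ A) * phiWeight χ x := mul_le_mul_of_nonneg_right h1 hg
      _ = (T ^ A)⁻¹ * (phiWeight χ x * (1 + |x|) ^ A) := by ring
  · rw [Set.indicator_of_notMem (by exact hx)]
    exact mul_nonneg (inv_nonneg.2 hTA.le) (mul_nonneg (phiWeight_nonneg χ x) (by positivity))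

/-- **The tail off the box**: `tailBox(T) ≤ 2m · T^{-A} M_A · M₂^{2m-1}` for `T ≥ 1`
("replace the domain of integration `I` by `ℝ` with a loss of `O_A(log^{-A} R)` … due to the rapid
decay of `φ`"). [cite: ConlonFoxZhao2014, Section 9] -/
theorem tailBox_le (A : ℕ) {T : ℝ} (hT : 1 ≤ T) :
    tailBox χ m T ≤ (2 * m : ℕ) * ((T ^ A)⁻¹ * weightMoment χ A) * (∫ x, phiWeight χ x) ^ (2 * m - 1) := by
  classical
  have hGi : Integrable (prodWeight χ) (fullMeasure m) := integrable_prodWeight hs hsupp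
  have hslot : ∀ v : Fin m ⊕ Fin m, Integrable
      (fun η : Fin m ⊕ Fin m → ℝ => {x : ℝ | T < |x|}.indicator (fun _ => prodWeight χ η) (η v)) (fullMeasure m) := by
    intro v
    simp_rw [← prod_slotF_eq]
    unfold fullMeasure
    refine Integrable.fintype_prod (f := fun u x => slotF χ T v u x) fun u => ?_
    unfold slotF
    split_ifs
    · exact (integrable_phiWeight hs hsupp).indicator (measurableSet_tailSet T)
    · exact integrable_phiWeight hs hsupp
  have hM0 : 0 ≤ ∫ x, phiWeight χ x := integral_nonneg (phiWeight_nonneg χ)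
  calc tailBox χ m T ≤ ∫ η, ∑ v, {x : ℝ | T < |x|}.indicator (fun _ => prodWeight χ η) (η v) ∂(fullMeasure m) :=
        integral_mono (hGi.indicator (measurableSet_box m T).compl) (integrable_finsetSum _ fun v _ => hslot v)
          (indicator_compl_box_le χ T)
    _ = ∑ v : Fin m ⊕ Fin m, tail₁ χ T * (∫ x, phiWeight χ x) ^ (2 * m - 1) := by
        rw [integral_finsetSum _ fun v _ => hslot v]
        exact sum_congr rfl fun v _ => integral_slot_tail χ T v
    _ = (2 * m : ℕ) * tail₁ χ T * (∫ x, phiWeight χ x) ^ (2 * m - 1) := by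
        rw [sum_const, card_univ, Fintype.card_sum, Fintype.card_fin, nsmul_eq_mul, ← two_mul, mul_assoc]
    _ ≤ (2 * m : ℕ) * ((T ^ A)⁻¹ * weightMoment χ A) * (∫ x, phiWeight χ x) ^ (2 * m - 1) := by
        gcongr
        exact tail₁_le hs hsupp A hT

end Tail

/-! ### The expectation side at fixed parameters -/

section Expectation

variable {t : ℕ}

/-- `moebiusDivisorSum χ R = divSum (moebiusWeight χ R) R` (definitional; the bridge between the
tree's `Λ_{χ,R}` and the `divSum` of `SmoothMajorantAssembly`). [cite: ConlonFoxZhao2014, Definition 8.2] -/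
theorem moebiusDivisorSum_eq_divSum (χ : ℝ → ℝ) (R : ℝ) (n : ℤ) :
    Literature.NumberTheory.Sieve.moebiusDivisorSum χ R n = divSum (Literature.NumberTheory.Sieve.moebiusWeight χ R) R n := rfl

/-- `Λ_{χ,R}(n) = log R · divSum (moebiusWeight χ R) R n`. [cite: ConlonFoxZhao2014, Definition 8.2] -/
theorem smoothDivisorSum_eq_divSum (χ : ℝ → ℝ) (R : ℝ) (n : ℤ) :
    smoothDivisorSum χ R n = Real.log R * divSum (Literature.NumberTheory.Sieve.moebiusWeight χ R) R n := by
  rw [smoothDivisorSum_eq_mul_moebiusDivisorSum]; rfl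

/-- `|μ(d) χ(log d/log R)| ≤ 1` for `|χ| ≤ 1`. [cite: ConlonFoxZhao2014, Section 9] -/
theorem abs_moebiusWeight_le {χ : ℝ → ℝ} (hχ1 : ∀ x, |χ x| ≤ 1) (R : ℝ) (d : ℕ) :
    |Literature.NumberTheory.Sieve.moebiusWeight χ R d| ≤ 1 := by
  unfold Literature.NumberTheory.Sieve.moebiusWeight
  rw [abs_mul]
  have h1 : |(ArithmeticFunction.moebius d : ℝ)| ≤ 1 := by exact_mod_cast ArithmeticFunction.abs_moebius_le_one
  exact mul_le_one₀ h1 (abs_nonneg _) (hχ1 _)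

/-- `μ(d) χ(log d/log R) = 0` unless `d` is square-free. [cite: ConlonFoxZhao2014, Section 9] -/
theorem moebiusWeight_eq_zero (χ : ℝ → ℝ) (R : ℝ) {d : ℕ} (hd : ¬Squarefree d) : Literature.NumberTheory.Sieve.moebiusWeight χ R d = 0 := by
  simp [Literature.NumberTheory.Sieve.moebiusWeight, ArithmeticFunction.moebius_eq_zero_of_not_squarefree hd]

/-- The tuple sum of (29) (without `(log R)^{2m}`) as a real number.
[cite: ConlonFoxZhao2014, Section 9, equation (29)] -/
def trueSumR (χ : ℝ → ℝ) (R : ℝ) (W : ℕ) (L : Fin m → Fin t → ℤ) (b : Fin m → ℤ) : ℝ :=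
  ∑ dd ∈ Fintype.piFinset (fun _ : Fin m ⊕ Fin m => Icc 1 ⌊R⌋₊),
    (∏ v, Literature.NumberTheory.Sieve.moebiusWeight χ R (dd v)) * tupleDensity W L b (fun j => dd (Sum.inl j)) (fun j => dd (Sum.inr j))

/-- `trueSumR = trueSumC` as complex numbers. [cite: ConlonFoxZhao2014, Section 9, equation (29)] -/
theorem trueSumR_cast (χ : ℝ → ℝ) (R : ℝ) (W : ℕ) (L : Fin m → Fin t → ℤ) (b : Fin m → ℤ) :
    (trueSumR χ R W L b : ℂ) = trueSumC χ R W L b := by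
  unfold trueSumR trueSumC Literature.NumberTheory.Sieve.moebiusWeight
  push_cast
  refine sum_congr rfl fun dd _ => ?_
  rw [prod_mul_distrib]
  ring

/-- **(28) → (29) with the explicit error**: for `|χ| ≤ 1`, `R ≥ 1` and box sides `ℓ_j ≥ R^{2m}`,
`E_{x∈B} ∏_i Λ_{χ,R}(θ_i(x))² = (log R)^{2m} (trueSumR + E₃)` with `|E₃| ≤ R^{2m} ∑_j R^{2m}/ℓ_j`.
[cite: ConlonFoxZhao2014, Section 9, equations (28)–(29)] -/
theorem exists_expect_eq {χ : ℝ → ℝ} (hχ1 : ∀ x, |χ x| ≤ 1) {R : ℝ} (hR : 1 ≤ R) (W : ℕ)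
    (L : Fin m → Fin t → ℤ) (b : Fin m → ℤ) (a : Fin t → ℤ) (ℓ : Fin t → ℕ) (hℓ : ∀ j, R ^ (2 * m) ≤ ℓ j) :
    ∃ E₃ : ℝ, |E₃| ≤ R ^ (2 * m) * ∑ j, R ^ (2 * m) / ℓ j ∧
      (𝔼 x ∈ Fintype.piFinset (fun j => Ico (a j) (a j + ℓ j)),
          ∏ i, smoothDivisorSum χ R (W * (∑ j, L i j * x j + b i) + 1) ^ 2) =
        Real.log R ^ (2 * m) * (trueSumR χ R W L b + E₃) := by
  set c := Literature.NumberTheory.Sieve.moebiusWeight χ R with hc_def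
  set Bx := Fintype.piFinset (fun j => Ico (a j) (a j + ℓ j)) with hBx_def
  refine ⟨∑ dd ∈ Fintype.piFinset (fun _ : Fin m ⊕ Fin m => Icc 1 ⌊R⌋₊), (∏ v, c (dd v)) *
      ((𝔼 x ∈ Bx, (if ∀ j, ((dd (Sum.inl j) : ℤ) ∣ wForm W (L j) (b j) x) ∧
          ((dd (Sum.inr j) : ℤ) ∣ wForm W (L j) (b j) x) then (1 : ℝ) else 0)) -
        tupleDensity W L b (fun j => dd (Sum.inl j)) (fun j => dd (Sum.inr j))), ?_, ?_⟩
  · exact abs_sum_coef_mul_expect_sub_tupleDensity_le c (abs_moebiusWeight_le hχ1 R)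
      (fun d hd => moebiusWeight_eq_zero χ R hd) hR W L b a ℓ hℓ
  · have h1 : ∀ x : Fin t → ℤ, ∏ i, smoothDivisorSum χ R (W * (∑ j, L i j * x j + b i) + 1) ^ 2 =
        ∏ i, (Real.log R * divSum c R (wForm W (L i) (b i) x)) ^ 2 := fun x =>
      Fintype.prod_congr _ _ fun i => by rw [wForm_int, smoothDivisorSum_eq_divSum]
    rw [Finset.expect_congr rfl fun x _ => h1 x, expect_prod_sq_divSum_eq c R (Real.log R) W L b Bx]
    unfold trueSumR
    rw [← sum_add_distrib]
    congr 1
    exact sum_congr rfl fun dd _ => by ring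

/-- **Normalisation, pure algebra**: from `|S - c (c_χ/K)^m| ≤ ErrM` and `|E₃| ≤ e₃`,
`|K^{2m}(S + E₃)/(c_χ^m K^m c) - 1| ≤ K^m (ErrM + e₃)/(c_χ^m c)`. [folklore] -/
theorem abs_ratio_sub_one_le {m : ℕ} {K cchi c S E₃ ErrM e₃ : ℝ} (hK : 0 < K) (hcchi : 0 < cchi) (hc : 1 ≤ c)
    (hS : |S - c * (cchi / K) ^ m| ≤ ErrM) (hE : |E₃| ≤ e₃) :
    |K ^ (2 * m) * (S + E₃) / (cchi ^ m * K ^ m * c) - 1| ≤ K ^ m * (ErrM + e₃) / (cchi ^ m * c) := by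
  have hc0 : 0 < c := by linarith
  have hK0 : K ≠ 0 := hK.ne'
  have hcchi0 : cchi ≠ 0 := hcchi.ne'
  have hc0' : c ≠ 0 := hc0.ne'
  have hid : K ^ (2 * m) * (S + E₃) / (cchi ^ m * K ^ m * c) - 1 =
      K ^ m * ((S - c * (cchi / K) ^ m) + E₃) / (cchi ^ m * c) := by
    rw [div_pow, pow_mul]
    field_simp
    ring
  rw [hid, abs_div, abs_of_pos (by positivity : 0 < cchi ^ m * c), abs_mul, abs_of_pos (pow_pos hK m)]
  have hnum : |S - c * (cchi / K) ^ m + E₃| ≤ ErrM + e₃ := (abs_add_le _ _).trans (add_le_add hS hE)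
  gcongr

/-- **Normalisation, the bookkeeping inequality**: with `κ = (2K)^{-m}` (`K^m κ = 2^{-m} ≤ 1`) and
`c ≥ 1`, `K^m ((E_t c κ M + (B + cκ) τ) + e)/(c_χ^m c) ≤ (E_t M + (B K^m + 1) τ + K^m e)/c_χ^m`. [folklore] -/
theorem fixed_algebra {m : ℕ} {K cchi c Et M B τ e : ℝ} (hK : 0 < K) (hcchi : 0 < cchi) (hc : 1 ≤ c)
    (hEt : 0 ≤ Et) (hM : 0 ≤ M) (hB : 0 ≤ B) (hτ : 0 ≤ τ) (he : 0 ≤ e) :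
    K ^ m * ((Et * c * ((2 * K) ^ m)⁻¹ * M + (B + c * ((2 * K) ^ m)⁻¹) * τ) + e) / (cchi ^ m * c) ≤
      (Et * M + (B * K ^ m + 1) * τ + K ^ m * e) / cchi ^ m := by
  have hc0 : 0 < c := by linarith
  have hK0 : K ≠ 0 := hK.ne'
  have hc0' : c ≠ 0 := hc0.ne'
  have h2K : (2 * K) ^ m ≠ 0 := pow_ne_zero _ (by positivity)
  have hKκ : K ^ m * ((2 * K) ^ m)⁻¹ ≤ 1 := by
    rw [mul_pow, mul_inv, ← mul_assoc, mul_comm (K ^ m), mul_assoc, mul_inv_cancel₀ (pow_ne_zero _ hK0), mul_one]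
    exact inv_le_one_of_one_le₀ (one_le_pow₀ (by norm_num))
  have hsplit : K ^ m * ((Et * c * ((2 * K) ^ m)⁻¹ * M + (B + c * ((2 * K) ^ m)⁻¹) * τ) + e) / (cchi ^ m * c) =
      (K ^ m * ((2 * K) ^ m)⁻¹ * (Et * M + τ) + K ^ m * (B * τ + e) / c) / cchi ^ m := by
    field_simp
    ring
  rw [hsplit]
  refine div_le_div_of_nonneg_right ?_ (by positivity)
  calc K ^ m * ((2 * K) ^ m)⁻¹ * (Et * M + τ) + K ^ m * (B * τ + e) / c
      ≤ 1 * (Et * M + τ) + K ^ m * (B * τ + e) :=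
        add_le_add (mul_le_mul_of_nonneg_right hKκ (by positivity)) (div_le_self (by positivity) hc)
    _ = Et * M + (B * K ^ m + 1) * τ + K ^ m * e := by ring

/-- `(c_χ W K/φ(W))^m = c_χ^m K^m (W/φ(W))^m`. [folklore] -/
theorem denom_pow_eq_mul_cW (cchi K : ℝ) (w m : ℕ) :
    (cchi * (primorial w : ℝ) * K / Nat.totient (primorial w)) ^ m = cchi ^ m * K ^ m * cW w m := by
  unfold cW
  rw [← inv_pow, ← mul_pow, ← mul_pow, inv_div]
  congr 1
  ring

end Expectation

/-- **The error at fixed parameters**, as a function of `(R, T, w)` (and the constants `K₀` of the zeta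
ratio, `C_B` of the dominator, the decay exponent `A`):
`(E_tot M₂^{2m} + ((log R + C_B)^{3m} e^{2·4^m} (log R)^m + 1) · 2m T^{-A} M_A M₂^{2m-1}`
`+ (log R)^m R^{2m} t R^{2m}/R^{10m}) / c_χ^m`. [cite: ConlonFoxZhao2014, Section 9] -/
def fixedErr (χ : ℝ → ℝ) (m n A : ℕ) (K₀ CB R T : ℝ) (w : ℕ) : ℝ :=
  (totErr K₀ (deltaOf R T) m w * (∫ x, phiWeight χ x) ^ (2 * m) +
      ((Real.log R + CB) ^ (3 * m) * Real.exp (2 * 4 ^ m) * Real.log R ^ m + 1) *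
        ((2 * m : ℕ) * ((T ^ A)⁻¹ * weightMoment χ A) * (∫ x, phiWeight χ x) ^ (2 * m - 1)) +
      Real.log R ^ m * (R ^ (2 * m) * ((n + 1 : ℕ) * (R ^ (2 * m) / R ^ (10 * m))))) / cChi χ ^ m

section Fixed

variable {n : ℕ} {R : ℝ} {w C₀ : ℕ} {L : Fin m → Fin (n + 1) → ℤ} {χ : ℝ → ℝ}

/-- **The estimate at fixed parameters**: under the standing hypotheses and the smallness conditions
of the box analysis (`δ ≤ δ₀`, `2δ log w ≤ 1/8`, `β ≤ 1/2`, `T ≥ 1`),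
`|E_{x∈B} ∏_i Λ_{χ,R}(θ_i(x))² / (c_χ W log R/φ(W))^m - 1| ≤ fixedErr`.
[cite: ConlonFoxZhao2014, Section 9, equations (28)–(38)] -/
theorem Setup.abs_expect_div_sub_one_le (S : Setup m n R w C₀ L) (hχ : IsSmoothCutoff χ) (hcχ : 0 < cChi χ)
    {T δ₀ K₀ : ℝ} (hT : 1 ≤ T) (hK₀ : 0 ≤ K₀)
    (hζ : ∀ z z' : ℂ, z ≠ 0 → z' ≠ 0 → z + z' ≠ 0 → ∀ δ : ℝ, δ ≤ δ₀ → ‖z‖ ≤ δ → ‖z'‖ ≤ δ →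
      ‖riemannZeta (1 + z + z') / (riemannZeta (1 + z) * riemannZeta (1 + z')) - z * z' / (z + z')‖ ≤
        K₀ * δ * ‖z * z' / (z + z')‖)
    (hδ₀ : deltaOf R T ≤ δ₀) (hδw : 2 * deltaOf R T * Real.log w ≤ 1 / 8)
    (hβ : betaErr (deltaOf R T) m w ≤ 1 / 2) {CB : ℝ} (hCB0 : 0 ≤ CB)
    (hCB : ∀ (b : Fin m → ℤ) (Q : ℕ) (η : Fin m ⊕ Fin m → ℝ),
      ‖∏ p ∈ Q.primesBelow, eulerFactor p (primorial w) L b (zL R η) (zR R η)‖ ≤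
        (Real.log R + CB) ^ (3 * m) * Real.exp (2 * 4 ^ m))
    (A : ℕ) (b : Fin m → ℤ) (a : Fin (n + 1) → ℤ) (ℓ : Fin (n + 1) → ℕ) (hℓ : ∀ j, R ^ (10 * m) ≤ ℓ j) :
    |(𝔼 x ∈ Fintype.piFinset (fun j => Ico (a j) (a j + ℓ j)),
        ∏ i, smoothDivisorSum χ R (primorial w * (∑ j, L i j * x j + b i) + 1) ^ 2) /
        (cChi χ * (primorial w : ℝ) * Real.log R / Nat.totient (primorial w)) ^ m - 1| ≤
      fixedErr χ m n A K₀ CB R T w := by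
  have hs := hχ.smooth
  have hsupp := hχ.eq_zero
  have hχ1 : ∀ x, |χ x| ≤ 1 := fun x => abs_le.2 ⟨by linarith [hχ.nonneg x], hχ.le_one x⟩
  have hR1 := S.one_lt
  have hK := S.log_pos
  set K := Real.log R with hK_def
  set c := cW w m with hc_def
  set B := (K + CB) ^ (3 * m) * Real.exp (2 * 4 ^ m) with hB_def
  set κ := ((2 * K) ^ m)⁻¹ with hκ_def
  set M₂ := ∫ x, phiWeight χ x with hM₂_def
  set τ := (2 * m : ℕ) * ((T ^ A)⁻¹ * weightMoment χ A) * M₂ ^ (2 * m - 1) with hτ_def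
  set Et := totErr K₀ (deltaOf R T) m w with hEt_def
  have hc1 : 1 ≤ c := one_le_cW w m
  have hM₂0 : 0 ≤ M₂ := integral_nonneg (phiWeight_nonneg χ)
  have hEt0 : 0 ≤ Et := totErr_nonneg hK₀ (deltaOf_nonneg (by linarith) hK) m w
  have hB0 : 0 ≤ B := by positivity
  have hτ0 : 0 ≤ τ := by
    have := weightMoment_nonneg χ A
    positivity
  -- Step 1: the expectation is `K^{2m} (S + E₃)`
  have hℓ' : ∀ j, R ^ (2 * m) ≤ ℓ j := fun j => (pow_le_pow_right₀ hR1.le (by omega)).trans (hℓ j)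
  obtain ⟨E₃, hE₃, hexp⟩ := exists_expect_eq hχ1 hR1.le (primorial w) L b a ℓ hℓ'
  have hE' : |E₃| ≤ R ^ (2 * m) * ((n + 1 : ℕ) * (R ^ (2 * m) / R ^ (10 * m))) := by
    refine hE₃.trans (mul_le_mul_of_nonneg_left ?_ (by positivity))
    have hR10 : 0 < R ^ (10 * m) := by positivity
    calc ∑ j, R ^ (2 * m) / (ℓ j : ℝ) ≤ ∑ _j : Fin (n + 1), R ^ (2 * m) / R ^ (10 * m) :=
          sum_le_sum fun j _ => div_le_div_of_nonneg_left (by positivity) hR10 (hℓ j)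
      _ = (n + 1 : ℕ) * (R ^ (2 * m) / R ^ (10 * m)) := by
          rw [sum_const, card_univ, Fintype.card_fin, nsmul_eq_mul]
  -- Step 2: `|S - c (c_χ/K)^m| ≤ ErrM`
  have hmain := S.norm_integral_limF_sub_main_le hs hsupp b (by linarith : (0 : ℝ) ≤ T) hK₀ hζ hδ₀ hδw hβ (hCB b)
  rw [← S.trueSumC_eq_integral hs hsupp b, integral_phiF_mainZ hs hsupp hR1, ← trueSumR_cast] at hmain
  have hS : |trueSumR χ R (primorial w) L b - c * (cChi χ / K) ^ m| ≤
      Et * c * κ * M₂ ^ (2 * m) + (B + c * κ) * τ := by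
    have hcast : ((trueSumR χ R (primorial w) L b : ℝ) : ℂ) -
        (c : ℂ) * ((K : ℂ)⁻¹ * ((∫ x in Set.Ioi (0 : ℝ), deriv χ x ^ 2 : ℝ) : ℂ)) ^ m =
          ((trueSumR χ R (primorial w) L b - c * (cChi χ / K) ^ m : ℝ) : ℂ) := by
      unfold cChi
      push_cast
      ring
    rw [hcast, Complex.norm_real, Real.norm_eq_abs] at hmain
    refine hmain.trans ?_
    gcongr
    exact tailBox_le hs hsupp A hT
  -- Step 3: algebra
  rw [hexp, denom_pow_eq_mul_cW]
  refine (abs_ratio_sub_one_le hK hcχ hc1 hS hE').trans ?_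
  exact fixed_algebra hK hcχ hc1 hEt0 (by positivity) hB0 hτ0 (by positivity)

end Fixed

/-! ### Elementary inequalities for the asymptotics -/

/-- `e^y - 1 ≤ y e^y` (equivalently `(1 - y) e^y ≤ 1`). [folklore] -/
theorem exp_sub_one_le_mul_exp (y : ℝ) : Real.exp y - 1 ≤ y * Real.exp y := by
  have h := Real.add_one_le_exp (-y)
  have hpos := Real.exp_pos y
  have h1 : (1 - y) * Real.exp y ≤ 1 := by
    calc (1 - y) * Real.exp y ≤ Real.exp (-y) * Real.exp y := by
          apply mul_le_mul_of_nonneg_right _ hpos.le; linarith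
      _ = 1 := by rw [← Real.exp_add]; simp
  nlinarith

/-- `(1 + x)^n - 1 ≤ e^{nx} - 1` for `x ≥ 0`. [folklore] -/
theorem one_add_pow_sub_one_le_exp {x : ℝ} (hx : 0 ≤ x) (n : ℕ) : (1 + x) ^ n - 1 ≤ Real.exp (n * x) - 1 := by
  have h1 : 1 + x ≤ Real.exp x := by have := Real.add_one_le_exp x; linarith
  have h2 : (1 + x) ^ n ≤ Real.exp x ^ n := pow_le_pow_left₀ (by linarith) h1 n
  rw [← Real.exp_nat_mul] at h2
  linarith

/-- **`β` is small when `δ w log w` is**: `β ≤ exp((w+1) · m(144 δ w) e^{m (144 δ w)}) - 1`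
(`π(w) ≤ w + 1`, `log w ≤ w`, `(1+x)^m - 1 ≤ m x e^{mx}`). [cite: ConlonFoxZhao2014, Section 9, equation (36)] -/
theorem betaErr_le {δ : ℝ} (hδ : 0 ≤ δ) (m w : ℕ) :
    betaErr δ m w ≤ Real.exp ((w + 1) * ((m * (144 * δ * w)) * Real.exp (m * (144 * δ * w)))) - 1 := by
  unfold betaErr
  set x := 144 * δ * Real.log w with hx_def
  set x' := 144 * δ * (w : ℝ) with hx'_def
  have hlog0 : 0 ≤ Real.log w := Real.log_natCast_nonneg w
  have hlogw : Real.log w ≤ w := by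
    rcases Nat.eq_zero_or_pos w with rfl | hw
    · simp
    · have hw' : (0 : ℝ) < w := by exact_mod_cast hw
      exact (Real.log_le_sub_one_of_pos hw').trans (by linarith)
  have hx0 : 0 ≤ x := by positivity
  have hxx' : x ≤ x' := by rw [hx_def, hx'_def]; gcongr
  set U := (1 + x) ^ m - 1 with hU_def
  have hU0 : 0 ≤ U := by have := one_le_pow₀ (by linarith : (1:ℝ) ≤ 1 + x) (n := m); linarith
  have hU : U ≤ (m * x') * Real.exp (m * x') := by
    calc U ≤ Real.exp (m * x) - 1 := one_add_pow_sub_one_le_exp hx0 m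
      _ ≤ (m * x) * Real.exp (m * x) := exp_sub_one_le_mul_exp _
      _ ≤ (m * x') * Real.exp (m * x') := by gcongr
  have hπ : (#((w + 1).primesBelow) : ℝ) ≤ w + 1 := by
    have : #((w + 1).primesBelow) ≤ w + 1 := (Finset.card_filter_le _ _).trans (by simp)
    exact_mod_cast this
  calc (1 + U) ^ #((w + 1).primesBelow) - 1 ≤ Real.exp (#((w + 1).primesBelow) * U) - 1 :=
        one_add_pow_sub_one_le_exp hU0 _
    _ ≤ Real.exp ((w + 1) * ((m * x') * Real.exp (m * x'))) - 1 := by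
        gcongr

/-- `s(K) = (1 + 2π√K)/K · K^{1/4} → 0` as `K → ∞` (it is `≤ (1 + 2π) K^{-1/4}` for `K ≥ 1`). [folklore] -/
theorem tendsto_deltaOf_mul_rpow :
    Tendsto (fun K : ℝ => (1 + 2 * π * Real.sqrt K) / K * K ^ (1 / 4 : ℝ)) atTop (𝓝 0) := by
  have hup : Tendsto (fun K : ℝ => (1 + 2 * π) * K ^ (-(1 / 4 : ℝ))) atTop (𝓝 0) := by
    rw [show (0:ℝ) = (1 + 2 * π) * 0 by ring]
    exact (tendsto_rpow_neg_atTop (by norm_num)).const_mul _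
  refine tendsto_of_tendsto_of_tendsto_of_le_of_le' tendsto_const_nhds hup ?_ ?_
  · filter_upwards [eventually_ge_atTop 0] with K hK; positivity
  · filter_upwards [eventually_ge_atTop 1] with K hK
    have hK0 : 0 < K := by linarith
    have hsq : Real.sqrt K = K ^ (1 / 2 : ℝ) := Real.sqrt_eq_rpow K
    have hs1 : 1 ≤ Real.sqrt K := by rw [show (1:ℝ) = Real.sqrt 1 by simp]; exact Real.sqrt_le_sqrt hK
    have h1 : 1 + 2 * π * Real.sqrt K ≤ (1 + 2 * π) * Real.sqrt K := by nlinarith [Real.pi_pos]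
    have hrp : Real.sqrt K / K * K ^ (1 / 4 : ℝ) = K ^ (-(1 / 4 : ℝ)) := by
      rw [hsq, div_eq_mul_inv, ← Real.rpow_neg_one, ← Real.rpow_add hK0, ← Real.rpow_add hK0]
      norm_num
    calc (1 + 2 * π * Real.sqrt K) / K * K ^ (1 / 4 : ℝ) ≤ (1 + 2 * π) * Real.sqrt K / K * K ^ (1 / 4 : ℝ) := by
          gcongr
      _ = (1 + 2 * π) * (Real.sqrt K / K * K ^ (1 / 4 : ℝ)) := by ring
      _ = (1 + 2 * π) * K ^ (-(1 / 4 : ℝ)) := by rw [hrp]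

/-- `log R = k⁻¹ 2^{-k-4} log N → ∞`. [cite: GreenTaoAnnals2008, Definition 9.3] -/
theorem tendsto_log_gyLevel_atTop {k : ℕ} (hk : 1 ≤ k) :
    Tendsto (fun N : ℕ => Real.log (gyLevel k N)) atTop atTop := by
  have he : 0 < (k : ℝ)⁻¹ * 2⁻¹ ^ (k + 4) := by positivity
  have h : (fun N : ℕ => Real.log (gyLevel k N)) = fun N : ℕ => ((k : ℝ)⁻¹ * 2⁻¹ ^ (k + 4)) * Real.log (N : ℝ) := by
    funext N; exact log_gyLevel k N
  rw [h]
  exact (Real.tendsto_log_atTop.comp tendsto_natCast_atTop_atTop).const_mul_atTop he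

/-- The growth bound `G(N) = ⌊(log R)^{1/8}⌋ → ∞` ("`w` grows sufficiently slowly with `N`").
[cite: ConlonFoxZhao2014, Proposition 8.3] -/
theorem tendsto_growth {k : ℕ} (hk : 1 ≤ k) :
    Tendsto (fun N : ℕ => ⌊Real.log (gyLevel k N) ^ (1 / 8 : ℝ)⌋₊) atTop atTop :=
  tendsto_nat_floor_atTop.comp ((tendsto_rpow_atTop (by norm_num : (0:ℝ) < 1 / 8)).comp (tendsto_log_gyLevel_atTop hk))

/-- For `K ≥ 1`, `1 ≤ w ≤ K^{1/8}`: `δ`, `δ log w`, `δ w ≤ δ K^{1/4}` and `(w+1) w δ ≤ 2 δ K^{1/4}`. [folklore] -/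
theorem smallness_bounds {K δ : ℝ} {w : ℕ} (hK : 1 ≤ K) (hδ : 0 ≤ δ) (hw1 : 1 ≤ w)
    (hwK : (w : ℝ) ≤ K ^ (1 / 8 : ℝ)) :
    δ ≤ δ * K ^ (1 / 4 : ℝ) ∧ δ * Real.log w ≤ δ * K ^ (1 / 4 : ℝ) ∧ δ * w ≤ δ * K ^ (1 / 4 : ℝ) ∧
      ((w : ℝ) + 1) * w * δ ≤ 2 * (δ * K ^ (1 / 4 : ℝ)) := by
  have hK0 : 0 ≤ K := by linarith
  have h18 : K ^ (1 / 8 : ℝ) ≤ K ^ (1 / 4 : ℝ) := Real.rpow_le_rpow_of_exponent_le hK (by norm_num)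
  have h14 : 1 ≤ K ^ (1 / 4 : ℝ) := Real.one_le_rpow hK (by norm_num)
  have hsq : (K ^ (1 / 8 : ℝ)) ^ 2 = K ^ (1 / 4 : ℝ) := by
    rw [← Real.rpow_natCast, ← Real.rpow_mul hK0]; norm_num
  have hw1' : (1 : ℝ) ≤ w := by exact_mod_cast hw1
  have hlogw : Real.log w ≤ w := (Real.log_le_sub_one_of_pos (by linarith)).trans (by linarith)
  have hlog0 : 0 ≤ Real.log w := Real.log_natCast_nonneg w
  refine ⟨le_mul_of_one_le_right hδ h14, ?_, ?_, ?_⟩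
  · exact mul_le_mul_of_nonneg_left (hlogw.trans (hwK.trans h18)) hδ
  · exact mul_le_mul_of_nonneg_left (hwK.trans h18) hδ
  · have hw2 : (w : ℝ) ^ 2 ≤ K ^ (1 / 4 : ℝ) := by
      rw [← hsq]; exact pow_le_pow_left₀ (by linarith) hwK 2
    nlinarith


/-! ### Sequences in `N` -/

section Seq

variable {k : ℕ}

/-- `K_N = log R_N`, `R_N = N^{k⁻¹2^{-k-4}}`. [cite: ConlonFoxZhao2014, Section 9] -/
abbrev logR (k N : ℕ) : ℝ := Real.log (gyLevel k N)
/-- `T_N = K_N^{1/2}`, the half-width of the box `I = [-log^{1/2} R, log^{1/2} R]`.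
[cite: ConlonFoxZhao2014, Section 9, equation (30)] -/
abbrev boxT (k N : ℕ) : ℝ := Real.sqrt (Real.log (gyLevel k N))
/-- `G_N = ⌊K_N^{1/8}⌋`, the growth bound for `w` ("`w` grows sufficiently slowly with `N`").
[cite: ConlonFoxZhao2014, Proposition 8.3] -/
abbrev growthG (k N : ℕ) : ℕ := ⌊Real.log (gyLevel k N) ^ (1 / 8 : ℝ)⌋₊

/-- `δ_N ≥ 0`. [cite: ConlonFoxZhao2014, Section 9] -/
theorem delta_nonneg (k N : ℕ) : 0 ≤ deltaOf (gyLevel k N) (boxT k N) := by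
  unfold deltaOf
  exact div_nonneg (by positivity) (log_gyLevel_nonneg k N)

/-- The master small quantity `s_N = δ_N K_N^{1/4} → 0` (`δ_N ≍ K_N^{-1/2}` for `T_N = K_N^{1/2}`).
[cite: ConlonFoxZhao2014, Section 9, "Estimate in (35)"] -/
theorem tendsto_s (hk : 1 ≤ k) :
    Tendsto (fun N => deltaOf (gyLevel k N) (boxT k N) * logR k N ^ (1 / 4 : ℝ)) atTop (𝓝 0) :=
  (tendsto_deltaOf_mul_rpow.comp (tendsto_log_gyLevel_atTop hk)).congr fun _ => rfl

/-- `δ_N → 0` ("`|z_j|, |z'_j| = O(log^{-1/2} R)`"). [cite: ConlonFoxZhao2014, Section 9, "Estimate in (35)"] -/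
theorem tendsto_delta (hk : 1 ≤ k) : Tendsto (fun N => deltaOf (gyLevel k N) (boxT k N)) atTop (𝓝 0) := by
  refine tendsto_of_tendsto_of_tendsto_of_le_of_le' tendsto_const_nhds (tendsto_s hk)
    (Eventually.of_forall fun N => delta_nonneg k N) ?_
  filter_upwards [(tendsto_log_gyLevel_atTop hk).eventually_ge_atTop 1] with N hN
  exact le_mul_of_one_le_right (delta_nonneg k N) (Real.one_le_rpow hN (by norm_num))

/-- `α_N → 0`. [cite: ConlonFoxZhao2014, Section 9, "Estimate in (35)"] -/
theorem tendsto_alpha (hk : 1 ≤ k) (K₀ : ℝ) (m : ℕ) :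
    Tendsto (fun N => alphaErr K₀ (deltaOf (gyLevel k N) (boxT k N)) m) atTop (𝓝 0) := by
  have hc : Continuous fun δ : ℝ => (1 + K₀ * δ) ^ m - 1 := by fun_prop
  have h := (hc.tendsto 0).comp (tendsto_delta hk)
  simp only [mul_zero, add_zero, one_pow, sub_self] at h
  exact h

/-- `β_N → 0` for `w ≤ G` ("`E'_p = (1 + O(log p/(p log^{1/2} R)))(1 - p^{-1})^m`", summed over `p ≤ w`).
[cite: ConlonFoxZhao2014, Section 9, "Estimate in (36)"] -/
theorem tendsto_beta (hk : 1 ≤ k) (m : ℕ) {w : ℕ → ℕ} (hw : Tendsto w atTop atTop) (hwG : ∀ N, w N ≤ growthG k N) :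
    Tendsto (fun N => betaErr (deltaOf (gyLevel k N) (boxT k N)) m (w N)) atTop (𝓝 0) := by
  set s : ℕ → ℝ := fun N => deltaOf (gyLevel k N) (boxT k N) * logR k N ^ (1 / 4 : ℝ) with hs_def
  have hs : Tendsto s atTop (𝓝 0) := tendsto_s hk
  have hY : Tendsto (fun N => Real.exp (2 * s N * (144 * m) * Real.exp (144 * m * s N)) - 1) atTop (𝓝 0) := by
    have hc : Continuous fun x : ℝ => Real.exp (2 * x * (144 * m) * Real.exp (144 * m * x)) - 1 := by fun_prop
    have h := (hc.tendsto 0).comp hs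
    simp only [mul_zero, zero_mul, Real.exp_zero, sub_self] at h
    exact h
  refine tendsto_of_tendsto_of_tendsto_of_le_of_le' tendsto_const_nhds hY
    (Eventually.of_forall fun N => betaErr_nonneg (delta_nonneg k N) _ _) ?_
  filter_upwards [(tendsto_log_gyLevel_atTop hk).eventually_ge_atTop 1, hw.eventually_ge_atTop 1] with N hK hw1
  have hδ := delta_nonneg k N
  set δ := deltaOf (gyLevel k N) (boxT k N) with hδ_def
  have hwK : (w N : ℝ) ≤ logR k N ^ (1 / 8 : ℝ) := (Nat.cast_le.2 (hwG N)).trans (Nat.floor_le (by positivity))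
  obtain ⟨-, -, h3, h4⟩ := smallness_bounds hK hδ hw1 hwK
  refine (betaErr_le hδ m (w N)).trans ?_
  have e2 : Real.exp (m * (144 * δ * w N)) = Real.exp (144 * m * (δ * w N)) := by congr 1; ring
  rw [e2]
  gcongr Real.exp ?_ - 1
  calc (w N + 1 : ℝ) * (m * (144 * δ * (w N)) * Real.exp (144 * m * (δ * w N)))
      = 144 * m * ((w N + 1) * w N * δ) * Real.exp (144 * m * (δ * w N)) := by ring
    _ ≤ 144 * m * (2 * s N) * Real.exp (144 * m * s N) := by gcongr
    _ = 2 * s N * (144 * m) * Real.exp (144 * m * s N) := by ring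

/-- `γ_N → 0` (`w → ∞`). [cite: ConlonFoxZhao2014, Section 9, equation (34)] -/
theorem tendsto_gamma (m : ℕ) {w : ℕ → ℕ} (hw : Tendsto w atTop atTop) :
    Tendsto (fun N => gammaErr m (w N)) atTop (𝓝 0) := by
  have h1 : Tendsto (fun N => deltaConst m / (w N : ℝ)) atTop (𝓝 0) :=
    tendsto_const_nhds.div_atTop (tendsto_natCast_atTop_atTop.comp hw)
  have h2 := ((Real.continuous_exp.tendsto 0).comp h1).sub_const 1
  rw [Real.exp_zero, sub_self] at h2
  exact h2

/-- The total relative error of the main term tends to `0`. [cite: ConlonFoxZhao2014, Section 9, equations (34)–(36)] -/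
theorem tendsto_totErr (hk : 1 ≤ k) (K₀ : ℝ) (m : ℕ) {w : ℕ → ℕ} (hw : Tendsto w atTop atTop)
    (hwG : ∀ N, w N ≤ growthG k N) :
    Tendsto (fun N => totErr K₀ (deltaOf (gyLevel k N) (boxT k N)) m (w N)) atTop (𝓝 0) := by
  have h := ((((tendsto_alpha hk K₀ m).const_add 1).mul
    (((tendsto_beta hk m hw hwG).const_mul 2).const_add 1)).mul ((tendsto_gamma m hw).const_add 1)).sub_const 1
  simp only [add_zero, mul_zero, mul_one, sub_self] at h
  exact h

/-- The tail coefficient `((K + C_B)^{3m} c K^m + 1) T^{-(8m+2)} → 0` for `T = K^{1/2}` (the `O_A(log^{-A} R)`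
losses with `A` large). [cite: ConlonFoxZhao2014, Section 9] -/
theorem tendsto_tailCoef (hk : 1 ≤ k) {CB c : ℝ} (hCB : 0 ≤ CB) (hc : 0 ≤ c) (m : ℕ) :
    Tendsto (fun N => ((logR k N + CB) ^ (3 * m) * c * logR k N ^ m + 1) * (boxT k N ^ (8 * m + 2))⁻¹) atTop (𝓝 0) := by
  have hup : Tendsto (fun N => ((1 + CB) ^ (3 * m) * c + 1) * (logR k N)⁻¹) atTop (𝓝 0) := by
    rw [show (0 : ℝ) = ((1 + CB) ^ (3 * m) * c + 1) * 0 by ring]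
    exact (tendsto_inv_atTop_zero.comp (tendsto_log_gyLevel_atTop hk)).const_mul _
  refine tendsto_of_tendsto_of_tendsto_of_le_of_le' tendsto_const_nhds hup ?_ ?_
  · refine Eventually.of_forall fun N => mul_nonneg ?_ (inv_nonneg.2 (pow_nonneg (Real.sqrt_nonneg _) _))
    have := log_gyLevel_nonneg k N
    positivity
  · filter_upwards [(tendsto_log_gyLevel_atTop hk).eventually_ge_atTop 1] with N hK
    set K := logR k N with hK_def
    have hK0 : 0 < K := by linarith
    have hT : boxT k N ^ (8 * m + 2) = K ^ (4 * m + 1) := by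
      rw [show 8 * m + 2 = 2 * (4 * m + 1) by ring, pow_mul, Real.sq_sqrt hK0.le]
    rw [hT]
    have h1 : (K + CB) ^ (3 * m) ≤ ((1 + CB) * K) ^ (3 * m) :=
      pow_le_pow_left₀ (by positivity) (by nlinarith) _
    have h2 : (K + CB) ^ (3 * m) * c * K ^ m + 1 ≤ ((1 + CB) ^ (3 * m) * c + 1) * K ^ (4 * m) := by
      have h3 : (1 : ℝ) ≤ K ^ (4 * m) := one_le_pow₀ hK
      calc (K + CB) ^ (3 * m) * c * K ^ m + 1 ≤ ((1 + CB) * K) ^ (3 * m) * c * K ^ m + K ^ (4 * m) := by gcongr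
        _ = ((1 + CB) ^ (3 * m) * c + 1) * K ^ (4 * m) := by rw [mul_pow]; ring
    calc ((K + CB) ^ (3 * m) * c * K ^ m + 1) * (K ^ (4 * m + 1))⁻¹
        ≤ (((1 + CB) ^ (3 * m) * c + 1) * K ^ (4 * m)) * (K ^ (4 * m + 1))⁻¹ := by gcongr
      _ = ((1 + CB) ^ (3 * m) * c + 1) * K⁻¹ := by rw [pow_succ]; field_simp

/-- The box error `(log R)^m R^{2m} · t R^{2m}/R^{10m} → 0` (the `O(R^{-6m} log^{2m} R)` of (29), normalised).
[cite: ConlonFoxZhao2014, Section 9, equation (29)] -/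
theorem tendsto_err3 (hk : 1 ≤ k) {m : ℕ} (hm : 1 ≤ m) (n : ℕ) :
    Tendsto (fun N => logR k N ^ m * (gyLevel k N ^ (2 * m) * ((n + 1 : ℕ) * (gyLevel k N ^ (2 * m) / gyLevel k N ^ (10 * m)))))
      atTop (𝓝 0) := by
  have hup : Tendsto (fun N => ((n + 1 : ℕ) : ℝ) * (logR k N)⁻¹) atTop (𝓝 0) := by
    rw [show (0 : ℝ) = ((n + 1 : ℕ) : ℝ) * 0 by ring]
    exact (tendsto_inv_atTop_zero.comp (tendsto_log_gyLevel_atTop hk)).const_mul _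
  refine tendsto_of_tendsto_of_tendsto_of_le_of_le' tendsto_const_nhds hup ?_ ?_
  · refine Eventually.of_forall fun N => ?_
    have := log_gyLevel_nonneg k N
    have := gyLevel_nonneg k N
    positivity
  · filter_upwards [(tendsto_log_gyLevel_atTop hk).eventually_ge_atTop 1] with N hK
    set K := logR k N with hK_def
    set R := gyLevel k N with hR_def
    have hR0 : 0 < R := by
      rcases (gyLevel_nonneg k N).lt_or_eq with h | h
      · exact h
      · exfalso
        have : K = 0 := by rw [hK_def]; show Real.log (gyLevel k N) = 0; rw [← h, Real.log_zero]
        linarith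
    have hKR : K ≤ R := (Real.log_le_sub_one_of_pos hR0).trans (by linarith)
    have hR1 : 1 ≤ R := hK.trans hKR
    have hK0 : 0 < K := by linarith
    have heq : K ^ m * (R ^ (2 * m) * ((n + 1 : ℕ) * (R ^ (2 * m) / R ^ (10 * m)))) =
        (n + 1 : ℕ) * (K ^ m * R ^ (4 * m)) / R ^ (10 * m) := by
      rw [show (4 : ℕ) * m = 2 * m + 2 * m by ring, pow_add]; ring
    rw [heq, div_le_iff₀ (by positivity)]
    have hkey : K ^ m * R ^ (4 * m) * K ≤ R ^ (10 * m) := by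
      calc K ^ m * R ^ (4 * m) * K = K ^ (m + 1) * R ^ (4 * m) := by ring
        _ ≤ R ^ (m + 1) * R ^ (4 * m) := by gcongr
        _ = R ^ (5 * m + 1) := by rw [← pow_add]; ring_nf
        _ ≤ R ^ (10 * m) := pow_le_pow_right₀ hR1 (by omega)
    calc ((n + 1 : ℕ) : ℝ) * (K ^ m * R ^ (4 * m)) = ((n + 1 : ℕ) : ℝ) * K⁻¹ * (K ^ m * R ^ (4 * m) * K) := by
          field_simp
      _ ≤ ((n + 1 : ℕ) : ℝ) * K⁻¹ * R ^ (10 * m) := by gcongr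

end Seq

/-! ### The error tends to zero along `N`, and the discharge -/

section Final

variable {k : ℕ}

/-- **`fixedErr → 0`** along `N → ∞` with `R = R_N`, `T = K_N^{1/2}`, `A = 8m + 2`, for every `w → ∞`
with `w ≤ G`. [cite: ConlonFoxZhao2014, Section 9] -/
theorem tendsto_fixedErr (χ : ℝ → ℝ) (hk : 1 ≤ k) {m : ℕ} (hm : 1 ≤ m) (n : ℕ) (K₀ : ℝ) {CB : ℝ} (hCB : 0 ≤ CB)
    {w : ℕ → ℕ} (hw : Tendsto w atTop atTop) (hwG : ∀ N, w N ≤ growthG k N) :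
    Tendsto (fun N => fixedErr χ m n (8 * m + 2) K₀ CB (gyLevel k N) (boxT k N) (w N)) atTop (𝓝 0) := by
  set M₂ := ∫ x, phiWeight χ x with hM₂_def
  set MA := weightMoment χ (8 * m + 2) with hMA_def
  have hE := tendsto_totErr hk K₀ m hw hwG
  have hP := tendsto_tailCoef hk hCB (Real.exp_pos (2 * 4 ^ m)).le m
  have hZ := tendsto_err3 hk hm n
  have h := (((hE.mul_const (M₂ ^ (2 * m))).add (hP.mul_const ((2 * m : ℕ) * MA * M₂ ^ (2 * m - 1)))).add hZ).div_const
    (cChi χ ^ m)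
  rw [show ((0 : ℝ) * M₂ ^ (2 * m) + 0 * ((2 * m : ℕ) * MA * M₂ ^ (2 * m - 1)) + 0) / cChi χ ^ m = 0 by simp] at h
  refine h.congr fun N => ?_
  unfold fixedErr
  ring

/-- **Conlon–Fox–Zhao, Proposition 8.3 (the smooth linear forms estimate), discharged** in the vendored
per-coefficient-bound form `SmoothLinearFormsEstimate` of `GreenTao2008SmoothMajorant`: with
`G(N) = ⌊(log R)^{1/8}⌋`, for every `w → ∞` with `w ≤ G` and every `ε > 0`, eventually in prime `N`,
for all integer systems with `|L_{ij}| ≤ C`, nonzero pairwise non-proportional rows, all shifts and all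
boxes of sides `≥ R^{10m}`, `|E_{x∈B} ∏_i Λ_{χ,R}(θ_i(x))² / (c_χ W log R/φ(W))^m - 1| ≤ ε`.
Proof: §9 of the source as formalised in `SmoothMajorantLocal/CRT/Density/Euler/Fourier/Zeta*/CChi/
Assembly/Main` and above (`T = log^{1/2} R`, `A = 8m + 2`).
[cite: ConlonFoxZhao2014, Proposition 8.3] [cite: GreenTao2010, Appendix D, Theorem D.3] -/
theorem smoothLinearFormsEstimate_holds : SmoothLinearFormsEstimate := by
  intro χ hχ hcχ k m t C hk hm ht
  obtain ⟨n, rfl⟩ : ∃ n, t = n + 1 := ⟨t - 1, by omega⟩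
  have hk1 : 1 ≤ k := by omega
  obtain ⟨δ₀, K₀, hδ₀pos, hK₀, hζ⟩ := norm_zetaRatio_sub_le
  obtain ⟨CB, hCB0, hCB⟩ := exists_norm_prod_eulerFactor_le
  refine ⟨fun N => growthG k N, tendsto_growth hk1, fun w hw hwG ε hε => ?_⟩
  have hK := tendsto_log_gyLevel_atTop hk1
  have hs := tendsto_s hk1
  have hδ := tendsto_delta hk1
  have hβ := tendsto_beta hk1 m hw hwG
  have hfix := tendsto_fixedErr χ hk1 hm n K₀ hCB0 hw hwG
  filter_upwards [hK.eventually_ge_atTop 1, hw.eventually_ge_atTop (max (21 * m + 2) (max (2 * C ^ 2) 1)),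
    hδ.eventually_le_const hδ₀pos, hs.eventually_le_const (show (0 : ℝ) < 1 / 16 by norm_num),
    hβ.eventually_le_const (show (0 : ℝ) < 1 / 2 by norm_num), hfix.eventually_le_const hε, eventually_ge_atTop 1]
    with N hKN hwN hδN hsN hβN hfixN hN1 _hNprime L hLC hL0 hLp b a ℓ hℓ
  have hR0 : 0 < gyLevel k N := lt_of_lt_of_le one_pos (one_le_gyLevel hN1)
  have hexp : Real.exp 1 ≤ gyLevel k N := (Real.le_log_iff_exp_le hR0).1 hKN
  have hw21 : 21 * m + 2 ≤ w N := le_trans (le_max_left _ _) hwN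
  have hwC : 2 * C ^ 2 ≤ w N := le_trans ((le_max_left _ _).trans (le_max_right _ _)) hwN
  have hw1 : 1 ≤ w N := le_trans ((le_max_right _ _).trans (le_max_right _ _)) hwN
  have S : Setup m n (gyLevel k N) (w N) C L := ⟨hexp, hw21, hwC, hLC, hL0, hLp⟩
  have hT : 1 ≤ boxT k N := by
    rw [show (1 : ℝ) = Real.sqrt 1 by simp]
    exact Real.sqrt_le_sqrt hKN
  have hwK : (w N : ℝ) ≤ logR k N ^ (1 / 8 : ℝ) := (Nat.cast_le.2 (hwG N)).trans (Nat.floor_le (by positivity))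
  obtain ⟨-, h2, -, -⟩ := smallness_bounds hKN (delta_nonneg k N) hw1 hwK
  have hδw : 2 * deltaOf (gyLevel k N) (boxT k N) * Real.log (w N) ≤ 1 / 8 := by linarith
  have hB : ∀ (b : Fin m → ℤ) (Q : ℕ) (η : Fin m ⊕ Fin m → ℝ),
      ‖∏ p ∈ Q.primesBelow, eulerFactor p (primorial (w N)) L b (zL (gyLevel k N) η) (zR (gyLevel k N) η)‖ ≤
        (Real.log (gyLevel k N) + CB) ^ (3 * m) * Real.exp (2 * 4 ^ m) :=
    fun b Q η => hCB m n _ S.one_le_log (w N) C hwC L hLC hL0 hLp b Q η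
  exact (S.abs_expect_div_sub_one_le hχ hcχ hT hK₀ hζ hδN hδw hβN hCB0 hB (8 * m + 2) b a ℓ hℓ).trans hfixN

/-- **Green–Tao's Theorem 1.1 from the relative Szemerédi theorem of Conlon–Fox–Zhao alone**: the
smooth linear forms estimate being proved above, the tree's reduction
`Literature.NumberTheory.Sieve.exists_prime_arithmetic_progression_of_smooth` needs only CFZ Thm. 4.3 (the named fact
`Literature.Combinatorics.Additive.CFZ.RelativeSzemeredi`, itself a consequence of Szemerédi's theorem by CFZ §§5–7).
[cite: ConlonFoxZhao2014, Theorem 1.1 (proof via Theorem 4.3 and Proposition 8.1)] -/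
theorem _root_.Literature.NumberTheory.Sieve.exists_prime_arithmetic_progression_of_relativeSzemeredi
    (hcfz : Literature.Combinatorics.Additive.CFZ.RelativeSzemeredi) : Literature.NumberTheory.Sieve.exists_prime_arithmetic_progression :=
  Literature.NumberTheory.Sieve.exists_prime_arithmetic_progression_of_smooth hcfz smoothLinearFormsEstimate_holds

end Final

end Literature.NumberTheory.Sieve.CFZ
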